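import Literature.NumberTheory.Transcendental.RoyCriterionProofs
import Mathlib.Analysis.Complex.AbsMax
import Mathlib.Analysis.Complex.TaylorSeries
import Mathlib.Analysis.Complex.Liouville
import Mathlib.Topology.UniformSpace.HeineCantor
import Mathlib.LinearAlgebra.Lagrange
import Mathlib.Algebra.Order.Round
import Mathlib.Analysis.Complex.ExponentialBounds
import Mathlib.Data.Nat.Choose.Bounds
import Mathlib.Algebra.BigOperators.Intervals
import Mathlib.Data.Nat.Factorial.BigOperators
import Mathlib.LinearAlgebra.LinearIndependent.Lemmas
import HarnessLib

/-!
# Roy's criterion — Theorem 2 of Roy 2001 (interpolation on `ℂ²`)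

Topic: `Literature/NumberTheory/Transcendental`. Companion of `RoyCriterionProofs.lean`; it
discharges the named fact `Literature.NumberTheory.Transcendental.Roy2001_thm2`
(**Roy 2001, Theorem 2**, p. 185): for a basis `{u, w}` of `ℂ²`, `v` with `v - a u ∈ ℂ w`,
there is `c ≥ 1` (with `u, v ∈ B(0, c)`) such that for every `N ≥ 1` satisfying the
Diophantine condition (2), all `R ≥ 2r`, `r ≥ cN` and every `F` continuous on the closed bidisc
`B(0, R)` and holomorphic inside,
`|F|_r ≤ (cr/N)^{N²} max |D_w^k F(mu + nv)| N^k/k! + (cr/R)^{N²} |F|_R`.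

## The proof given here (Roy 2001, §§2–3, in one-variable slices)

Roy proves Theorem 2 through a two-variable Cauchy-kernel expansion (Prop. 1) and a
two-variable Taylor expansion (Lemma 3). Mathlib (at the pin of this tree) has no Cauchy
formula or Taylor expansion on polydiscs, so the same architecture is run on complex lines,
where only one-variable tools are needed (`Complex.hasSum_taylorSeries_on_ball`, Cauchy's
estimates `Complex.norm_iteratedDeriv_le_of_forall_mem_sphere_norm_le`, the maximum modulus
principle `Complex.norm_le_of_forall_mem_frontier_norm_le`, `Lagrange.eq_interpolate`):

* `norm_le_torusSup` — the maximum modulus principle on the bidisc (p. 185: `|F|_R` is the sup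
  of `|F|` on `B(0, R)`), from the one-variable principle on interior tori and uniform
  continuity on the closed bidisc.
* Write `v = a u + b w`, `G(z, ω) = F(z u + ω w)`; the interpolation points are
  `m u + n v = x_{mn} u + n b w` with `x_{mn} = m + n a`, and `D_w^k F (mu + nv)` is the `k`-th
  derivative of the slice `t ↦ F(mu + nv + t w)` at `0` (this is `dirIteratedDeriv`).
  **Step 1** (`norm_le_of_taylor_coeff_le`): Taylor expansion of that slice with the `N²` given
  derivatives and Cauchy estimates for the tail bounds `G(x_{mn}, ω)` for `|ω| ≲ N`.
  **Step 2** (`norm_le_of_interpolation`, `roy_lagrange_basis_le`): for fixed `ω`, the slice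
  `ξ ↦ G(ξ, ω)` is interpolated at the `N²` nodes `x_{mn}`: its Taylor polynomial of degree
  `< N²` is its own Lagrange interpolant, the tail is controlled by Cauchy's estimates, and the
  Lagrange basis polynomials are bounded through **Lemma 1** of Roy 2001
  (`roy_row_prod_ge`, `roy_denominator_ge`: under (2), `∏_{j ≠ i} |x_i - x_j| ≥ ((N-1)!/8^N)^N`).
  This bounds `F` on the closed bidisc of radius `N` (`exists_coords`: Cramer's rule).
  **Step 3** (Roy's Lemma 3 along lines through `0`): the slice `t ↦ F(t p/r)` has its first
  `N²` Taylor coefficients controlled by the bound on `B(0, N)` and its tail by `|F|_R`, which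
  gives `|F(p)| ≤ N² (r/N)^{N²} sup_{B(0,N)} |F| + 2 (r/R)^{N²} |F|_R` for `‖p‖ ≤ r`.
* `thm2_bookkeeping` collects the constants; the resulting admissible constant is
  `c = max{1, ‖u‖+‖v‖+‖w‖, 8·48(κ+α)(κ+β)·max{1, 2(‖u‖+‖w‖)(κ+α+β)}}` with `α = 1 + |a|`,
  `β = |b|`, `κ = max{1, 2(‖u‖+‖w‖)/|u₁w₂ - u₂w₁|}`.

## Source

* D. Roy, *An arithmetic criterion for the values of the exponential function*, Acta Arith. 97
  (2001), 183–194: Theorem 2 (p. 185), Lemma 1 (p. 186), Prop. 1 (p. 187), Lemma 3 and the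
  proof of Theorem 2 (pp. 189–190). [Roy2001]

## Design choices

* No new definitions: the torus `{|z₁| = |z₂| = ρ}` is written as a set literal, slices as
  lambdas, the nodes through a hypothesis `hx : ∀ j, x j = j.1 + j.2 * a` on
  `x : Fin N × Fin N → ℂ`.
* Constants are explicit but not optimised (Roy: "a suitable constant `c` depending only on
  `c₂, c₃, c₄`").
-/

noncomputable section

open Complex Metric Set

namespace Literature.NumberTheory.Transcendental

/-! ### Complex-line slices of a function on the bidisc -/

/-- A complex-line slice `t ↦ F (p + t • d)` of a function holomorphic on the open bidisc
`‖·‖ < R` of `ℂ²` and continuous on the closed one is `DiffContOnCl` on `|t| < Θ` as soon as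
`‖p‖ + Θ ‖d‖ ≤ R`. [folklore] -/
theorem diffContOnCl_slice {F : ℂ × ℂ → ℂ} {R : ℝ} (hF : DiffContOnCl ℂ F (ball 0 R))
    (p d : ℂ × ℂ) {Θ : ℝ} (hpd : ‖p‖ + Θ * ‖d‖ ≤ R) :
    DiffContOnCl ℂ (fun t : ℂ => F (p + t • d)) (ball 0 Θ) := by
  by_cases hd : d = 0
  · simp only [hd, smul_zero, add_zero]
    exact diffContOnCl_const
  have hdpos : 0 < ‖d‖ := norm_pos_iff.2 hd
  have hmaps : MapsTo (fun t : ℂ => p + t • d) (ball 0 Θ) (ball 0 R) := by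
    intro t ht
    rw [mem_ball_zero_iff] at ht ⊢
    calc ‖p + t • d‖ ≤ ‖p‖ + ‖t‖ * ‖d‖ := (norm_add_le _ _).trans (by rw [norm_smul])
      _ < ‖p‖ + Θ * ‖d‖ := by gcongr
      _ ≤ R := hpd
  have hdiff : Differentiable ℂ (fun t : ℂ => p + t • d) := by fun_prop
  exact hF.comp hdiff.diffContOnCl hmaps

/-- Points of a slice `p + t • d`, `|t| ≤ Θ`, `‖p‖ + Θ‖d‖ ≤ R`, lie in the closed bidisc of
radius `R`. [folklore] -/
theorem norm_add_smul_le_of_slice (p d : ℂ × ℂ) {Θ R : ℝ} (hpd : ‖p‖ + Θ * ‖d‖ ≤ R) {t : ℂ}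
    (ht : ‖t‖ ≤ Θ) : ‖p + t • d‖ ≤ R :=
  (norm_add_le _ _).trans (by rw [norm_smul]; nlinarith [norm_nonneg d])

/-! ### One-variable Taylor expansion with Cauchy estimates for the tail -/

/-- Taylor expansion at `0` with the Cauchy estimate for the tail: if `f` is holomorphic on
`|t| < Θ`, continuous on `|t| ≤ Θ` and bounded by `M` on `|t| = Θ`, then for `|y| ≤ Θ/2`,
`|f(y) - ∑_{k<L} f^{(k)}(0) y^k / k!| ≤ 2 M (|y|/Θ)^L`. [folklore] -/
theorem norm_sub_taylor_le {f : ℂ → ℂ} {Θ M : ℝ} (hΘ : 0 < Θ) (hf : DiffContOnCl ℂ f (ball 0 Θ))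
    (hM : ∀ w ∈ sphere (0 : ℂ) Θ, ‖f w‖ ≤ M) (L : ℕ) {y : ℂ} (hy : ‖y‖ ≤ Θ / 2) :
    ‖f y - ∑ k ∈ Finset.range L, (k.factorial : ℂ)⁻¹ * (y ^ k * iteratedDeriv k f 0)‖ ≤
      2 * M * (‖y‖ / Θ) ^ L := by
  have hyΘ : y ∈ ball (0 : ℂ) Θ := by
    rw [mem_ball_zero_iff]; linarith
  have hsum := Complex.hasSum_taylorSeries_on_ball hf.differentiableOn hyΘ
  simp only [sub_zero, smul_eq_mul] at hsum
  have hM0 : 0 ≤ M := (norm_nonneg _).trans (hM (Θ : ℂ) (by simp [hΘ.le]))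
  set x : ℝ := ‖y‖ / Θ with hx
  have hx0 : 0 ≤ x := div_nonneg (norm_nonneg _) hΘ.le
  have hx2 : x ≤ 1 / 2 := by rw [hx, div_le_iff₀ hΘ]; linarith
  have hx1 : x < 1 := by linarith
  have htail := (hasSum_nat_add_iff' L).2 hsum
  have hg : HasSum (fun n : ℕ => M * x ^ L * x ^ n) (M * x ^ L * (1 - x)⁻¹) :=
    (hasSum_geometric_of_lt_one hx0 hx1).mul_left _
  have hbound : ∀ n : ℕ, ‖((((n + L).factorial : ℕ) : ℂ))⁻¹ *
      (y ^ (n + L) * iteratedDeriv (n + L) f 0)‖ ≤ M * x ^ L * x ^ n := by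
    intro n
    have hc := Complex.norm_iteratedDeriv_le_of_forall_mem_sphere_norm_le (n + L) hΘ hf hM
    have hfac : ((n + L).factorial : ℝ) ≠ 0 := by positivity
    rw [norm_mul, norm_mul, norm_inv, Complex.norm_natCast, norm_pow]
    calc (((n + L).factorial : ℝ))⁻¹ * (‖y‖ ^ (n + L) * ‖iteratedDeriv (n + L) f 0‖)
        ≤ (((n + L).factorial : ℝ))⁻¹ * (‖y‖ ^ (n + L) *
            ((n + L).factorial * M / Θ ^ (n + L))) := by gcongr
      _ = M * (‖y‖ / Θ) ^ (n + L) := by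
          rw [div_pow]; field_simp
      _ = M * x ^ L * x ^ n := by rw [hx, pow_add]; ring
  have hle := htail.norm_le_of_bounded hg hbound
  have hinv : (1 - x)⁻¹ ≤ 2 := by
    have h := inv_anti₀ (by norm_num : (0 : ℝ) < 1 / 2) (by linarith : 1 / 2 ≤ 1 - x)
    norm_num at h
    exact h
  calc ‖f y - ∑ k ∈ Finset.range L, (k.factorial : ℂ)⁻¹ * (y ^ k * iteratedDeriv k f 0)‖
      ≤ M * x ^ L * (1 - x)⁻¹ := hle
    _ ≤ M * x ^ L * 2 := by gcongr
    _ = 2 * M * x ^ L := by ring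

/-- If moreover the first `L` Taylor coefficients satisfy `|f^{(k)}(0)|/k! ≤ D σ^{-k}`, then
`|f(y)| ≤ L (τ/σ)^L D + 2 M (τ/Θ)^L` for `|y| ≤ τ`, `σ ≤ τ ≤ Θ/2` (Roy 2001, proof of Lemma 3,
one-variable form). [cite: Roy2001, Lemma 3 (proof)] -/
theorem norm_le_of_taylor_coeff_le {f : ℂ → ℂ} {Θ M D σ τ : ℝ} (hΘ : 0 < Θ)
    (hf : DiffContOnCl ℂ f (ball 0 Θ)) (hM : ∀ w ∈ sphere (0 : ℂ) Θ, ‖f w‖ ≤ M) {L : ℕ}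
    (hD : 0 ≤ D) (hσ : 0 < σ)
    (hhead : ∀ k < L, ‖iteratedDeriv k f 0‖ / k.factorial ≤ D / σ ^ k)
    (hστ : σ ≤ τ) (hτΘ : τ ≤ Θ / 2) {y : ℂ} (hy : ‖y‖ ≤ τ) :
    ‖f y‖ ≤ L * (τ / σ) ^ L * D + 2 * M * (τ / Θ) ^ L := by
  have hM0 : 0 ≤ M := (norm_nonneg _).trans (hM (Θ : ℂ) (by simp [hΘ.le]))
  have hτ0 : 0 ≤ τ := hσ.le.trans hστ
  have htail := norm_sub_taylor_le hΘ hf hM L (hy.trans hτΘ)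
  have hone : 1 ≤ τ / σ := by rwa [le_div_iff₀ hσ, one_mul]
  have hterm : ∀ k ∈ Finset.range L,
      ‖(k.factorial : ℂ)⁻¹ * (y ^ k * iteratedDeriv k f 0)‖ ≤ (τ / σ) ^ L * D := by
    intro k hk
    have hkL : k < L := Finset.mem_range.1 hk
    have hfac : (k.factorial : ℝ) ≠ 0 := by positivity
    rw [norm_mul, norm_mul, norm_inv, Complex.norm_natCast, norm_pow]
    have h1 : ‖iteratedDeriv k f 0‖ ≤ k.factorial * (D / σ ^ k) := by
      have := hhead k hkL
      rwa [div_le_iff₀' (by positivity : (0 : ℝ) < k.factorial)] at this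
    calc (k.factorial : ℝ)⁻¹ * (‖y‖ ^ k * ‖iteratedDeriv k f 0‖)
        ≤ (k.factorial : ℝ)⁻¹ * (τ ^ k * (k.factorial * (D / σ ^ k))) := by gcongr
      _ = (τ / σ) ^ k * D := by rw [div_pow]; field_simp
      _ ≤ (τ / σ) ^ L * D :=
          mul_le_mul_of_nonneg_right (pow_le_pow_right₀ hone hkL.le) hD
  have hhead' : ‖∑ k ∈ Finset.range L, (k.factorial : ℂ)⁻¹ * (y ^ k * iteratedDeriv k f 0)‖ ≤
      L * ((τ / σ) ^ L * D) := by
    calc _ ≤ ∑ k ∈ Finset.range L, ‖(k.factorial : ℂ)⁻¹ * (y ^ k * iteratedDeriv k f 0)‖ :=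
          norm_sum_le _ _
      _ ≤ ∑ _k ∈ Finset.range L, (τ / σ) ^ L * D := Finset.sum_le_sum hterm
      _ = L * ((τ / σ) ^ L * D) := by rw [Finset.sum_const, Finset.card_range, nsmul_eq_mul]
  have hyτ : (‖y‖ / Θ) ^ L ≤ (τ / Θ) ^ L :=
    pow_le_pow_left₀ (div_nonneg (norm_nonneg _) hΘ.le) (div_le_div_of_nonneg_right hy hΘ.le) L
  calc ‖f y‖ ≤ ‖∑ k ∈ Finset.range L, (k.factorial : ℂ)⁻¹ * (y ^ k * iteratedDeriv k f 0)‖ +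
        ‖f y - ∑ k ∈ Finset.range L, (k.factorial : ℂ)⁻¹ * (y ^ k * iteratedDeriv k f 0)‖ :=
        norm_le_insert' _ _
    _ ≤ L * ((τ / σ) ^ L * D) + 2 * M * (‖y‖ / Θ) ^ L := add_le_add hhead' htail
    _ ≤ L * ((τ / σ) ^ L * D) + 2 * M * (τ / Θ) ^ L := by gcongr
    _ = L * (τ / σ) ^ L * D + 2 * M * (τ / Θ) ^ L := by ring

/-! ### The maximum modulus principle on the bidisc -/

/-- The torus `|z₁| = |z₂| = ρ` lies in the closed bidisc of radius `ρ`. [folklore] -/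
theorem torus_subset_closedBall (ρ : ℝ) :
    {z : ℂ × ℂ | ‖z.1‖ = ρ ∧ ‖z.2‖ = ρ} ⊆ closedBall (0 : ℂ × ℂ) ρ := by
  intro z hz
  rw [mem_closedBall_zero_iff, Prod.norm_def, hz.1, hz.2, max_self]

/-- The torus `|z₁| = |z₂| = ρ` is compact. [folklore] -/
theorem isCompact_torus (ρ : ℝ) : IsCompact {z : ℂ × ℂ | ‖z.1‖ = ρ ∧ ‖z.2‖ = ρ} := by
  have : {z : ℂ × ℂ | ‖z.1‖ = ρ ∧ ‖z.2‖ = ρ} = sphere (0 : ℂ) ρ ×ˢ sphere (0 : ℂ) ρ := by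
    ext z; simp
  rw [this]
  exact (isCompact_sphere 0 ρ).prod (isCompact_sphere 0 ρ)

/-- `|F|` is bounded on every torus of radius `ρ ≤ R` inside the closed bidisc. [folklore] -/
theorem bddAbove_torus_image {F : ℂ × ℂ → ℂ} {R ρ : ℝ}
    (hF : DiffContOnCl ℂ F (ball 0 R)) (hρR : ρ ≤ R) :
    BddAbove ((fun z => ‖F z‖) '' {z : ℂ × ℂ | ‖z.1‖ = ρ ∧ ‖z.2‖ = ρ}) := by
  have hc : ContinuousOn (fun z => ‖F z‖) {z : ℂ × ℂ | ‖z.1‖ = ρ ∧ ‖z.2‖ = ρ} :=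
    (hF.continuousOn_ball.mono
      ((torus_subset_closedBall ρ).trans (closedBall_subset_closedBall hρR))).norm
  exact ((isCompact_torus ρ).image_of_continuousOn hc).bddAbove

/-- On the torus of radius `R` itself, `|F| ≤ |F|_R`. [folklore] -/
theorem norm_le_torusSup_of_mem_torus {F : ℂ × ℂ → ℂ} {R : ℝ}
    (hF : DiffContOnCl ℂ F (ball 0 R)) {z : ℂ × ℂ} (hz : ‖z.1‖ = R ∧ ‖z.2‖ = R) :
    ‖F z‖ ≤ torusSup F R :=
  le_csSup (bddAbove_torus_image hF le_rfl) ⟨z, hz, rfl⟩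

/-- Maximum modulus on an interior bidisc, from the one-variable principle applied twice: if `F`
is holomorphic on `‖·‖ < R` and `|F| ≤ S` on the torus of radius `ρ < R`, then `|F| ≤ S` on the
closed bidisc of radius `ρ`. [folklore] -/
theorem norm_le_of_forall_torus_le {F : ℂ × ℂ → ℂ} {R ρ S : ℝ}
    (hF : DifferentiableOn ℂ F (ball 0 R)) (hρ : 0 < ρ) (hρR : ρ < R)
    (hS : ∀ z : ℂ × ℂ, ‖z.1‖ = ρ → ‖z.2‖ = ρ → ‖F z‖ ≤ S) {p : ℂ × ℂ} (hp : ‖p‖ ≤ ρ) :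
    ‖F p‖ ≤ S := by
  have hp1 : ‖p.1‖ ≤ ρ := (norm_fst_le p).trans hp
  have hp2 : ‖p.2‖ ≤ ρ := (norm_snd_le p).trans hp
  -- slices in the first variable
  have hsl1 : ∀ ζ : ℂ, ‖ζ‖ ≤ ρ → DiffContOnCl ℂ (fun ξ : ℂ => F (ξ, ζ)) (ball 0 ρ) := by
    intro ζ hζ
    have hd : DifferentiableOn ℂ (fun ξ : ℂ => F (ξ, ζ)) (closedBall 0 ρ) := by
      refine hF.comp (by fun_prop) fun ξ hξ => ?_
      rw [mem_closedBall_zero_iff] at hξ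
      rw [mem_ball_zero_iff, Prod.norm_def]
      exact max_lt (lt_of_le_of_lt hξ hρR) (lt_of_le_of_lt hζ hρR)
    exact (hd.mono closure_ball_subset_closedBall).diffContOnCl
  have hsl2 : ∀ ξ : ℂ, ‖ξ‖ ≤ ρ → DiffContOnCl ℂ (fun ζ : ℂ => F (ξ, ζ)) (ball 0 ρ) := by
    intro ξ hξ
    have hd : DifferentiableOn ℂ (fun ζ : ℂ => F (ξ, ζ)) (closedBall 0 ρ) := by
      refine hF.comp (by fun_prop) fun ζ hζ => ?_
      rw [mem_closedBall_zero_iff] at hζ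
      rw [mem_ball_zero_iff, Prod.norm_def]
      exact max_lt (lt_of_le_of_lt hξ hρR) (lt_of_le_of_lt hζ hρR)
    exact (hd.mono closure_ball_subset_closedBall).diffContOnCl
  -- first: for `|ζ| = ρ`, `|F(ξ, ζ)| ≤ S` for all `|ξ| ≤ ρ`
  have step1 : ∀ ζ : ℂ, ‖ζ‖ = ρ → ∀ ξ : ℂ, ‖ξ‖ ≤ ρ → ‖F (ξ, ζ)‖ ≤ S := by
    intro ζ hζ ξ hξ
    have hfr : ∀ z ∈ frontier (ball (0 : ℂ) ρ), ‖F (z, ζ)‖ ≤ S := by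
      intro z hz
      rw [frontier_ball (0 : ℂ) hρ.ne', mem_sphere_zero_iff_norm] at hz
      exact hS (z, ζ) hz hζ
    have hcl : ξ ∈ closure (ball (0 : ℂ) ρ) := by
      rw [closure_ball (0 : ℂ) hρ.ne']; exact mem_closedBall_zero_iff.2 hξ
    exact Complex.norm_le_of_forall_mem_frontier_norm_le isBounded_ball (hsl1 ζ hζ.le) hfr hcl
  -- second: maximum modulus in `ζ` at fixed `ξ = p.1`
  have hfr : ∀ z ∈ frontier (ball (0 : ℂ) ρ), ‖F (p.1, z)‖ ≤ S := by
    intro z hz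
    rw [frontier_ball (0 : ℂ) hρ.ne', mem_sphere_zero_iff_norm] at hz
    exact step1 z hz p.1 hp1
  have hcl : p.2 ∈ closure (ball (0 : ℂ) ρ) := by
    rw [closure_ball (0 : ℂ) hρ.ne']; exact mem_closedBall_zero_iff.2 hp2
  exact Complex.norm_le_of_forall_mem_frontier_norm_le isBounded_ball (hsl2 p.1 hp1) hfr hcl

/-- **Maximum modulus principle on the bidisc** (Roy 2001, p. 185: "`|F|_R` coincides with the
supremum of `|F|` on `B(0, R)`"): if `F` is holomorphic on the open bidisc of radius `R` and
continuous on the closed one, then `|F(p)| ≤ |F|_R` for `‖p‖ ≤ R`. [cite: Roy2001, §1 (p. 185)] -/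
theorem norm_le_torusSup {F : ℂ × ℂ → ℂ} {R : ℝ} (hR : 0 < R) (hF : DiffContOnCl ℂ F (ball 0 R))
    {p : ℂ × ℂ} (hp : ‖p‖ ≤ R) : ‖F p‖ ≤ torusSup F R := by
  set S := torusSup F R with hSdef
  have hcont : ContinuousOn F (closedBall (0 : ℂ × ℂ) R) := hF.continuousOn_ball
  have huc : UniformContinuousOn F (closedBall (0 : ℂ × ℂ) R) :=
    (isCompact_closedBall 0 R).uniformContinuousOn_of_continuous hcont
  refine le_of_forall_pos_lt_add fun ε hε => ?_
  obtain ⟨δ, hδ, hδε⟩ := Metric.uniformContinuousOn_iff.1 huc (ε / 2) (half_pos hε)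
  -- shrink factor `1 - η ∈ (0,1)` with `η R < δ`
  obtain ⟨η, hη0, hη1, hηδ⟩ : ∃ η : ℝ, 0 < η ∧ η ≤ 1 / 2 ∧ η * R < δ := by
    refine ⟨min (1 / 2) (δ / (2 * R)), lt_min (by norm_num) (by positivity), min_le_left _ _, ?_⟩
    have : min (1 / 2) (δ / (2 * R)) * R ≤ δ / (2 * R) * R :=
      mul_le_mul_of_nonneg_right (min_le_right _ _) hR.le
    have h2 : δ / (2 * R) * R = δ / 2 := by field_simp
    linarith
  have hs0 : 0 < 1 - η := by linarith
  have hs1 : 1 - η < 1 := by linarith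
  have hsne : (1 - η) ≠ 0 := hs0.ne'
  have hρ0 : 0 < (1 - η) * R := mul_pos hs0 hR
  have hρR : (1 - η) * R < R := by nlinarith
  -- bound on the torus of radius `(1 - η) R`
  have htorus : ∀ z : ℂ × ℂ, ‖z.1‖ = (1 - η) * R → ‖z.2‖ = (1 - η) * R →
      ‖F z‖ ≤ S + ε / 2 := by
    intro z hz1 hz2
    have hznorm : ‖z‖ = (1 - η) * R := by rw [Prod.norm_def, hz1, hz2, max_self]
    have hz'1 : ‖((1 - η)⁻¹ • z).1‖ = R := by
      rw [Prod.smul_fst, norm_smul, Real.norm_eq_abs, abs_of_pos (inv_pos.2 hs0), hz1]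
      field_simp
    have hz'2 : ‖((1 - η)⁻¹ • z).2‖ = R := by
      rw [Prod.smul_snd, norm_smul, Real.norm_eq_abs, abs_of_pos (inv_pos.2 hs0), hz2]
      field_simp
    have hzR : z ∈ closedBall (0 : ℂ × ℂ) R :=
      mem_closedBall_zero_iff.2 (hznorm.le.trans hρR.le)
    have hz'R : (1 - η)⁻¹ • z ∈ closedBall (0 : ℂ × ℂ) R := by
      rw [mem_closedBall_zero_iff, Prod.norm_def, hz'1, hz'2, max_self]
    have hdist : dist z ((1 - η)⁻¹ • z) < δ := by
      have h1 : z - (1 - η)⁻¹ • z = (1 - (1 - η)⁻¹) • z := by rw [sub_smul, one_smul]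
      have hinv : 1 ≤ (1 - η)⁻¹ := (one_le_inv₀ hs0).2 hs1.le
      have h2 : |1 - (1 - η)⁻¹| = η / (1 - η) := by
        rw [abs_of_nonpos (by linarith), neg_sub]
        field_simp
        ring
      rw [dist_eq_norm, h1, norm_smul, Real.norm_eq_abs, h2, hznorm]
      calc η / (1 - η) * ((1 - η) * R) = η * R := by field_simp
        _ < δ := hηδ
    have h1 := hδε z hzR _ hz'R hdist
    rw [dist_eq_norm] at h1
    have h2 : ‖F ((1 - η)⁻¹ • z)‖ ≤ S := norm_le_torusSup_of_mem_torus hF ⟨hz'1, hz'2⟩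
    calc ‖F z‖ ≤ ‖F ((1 - η)⁻¹ • z)‖ + ‖F z - F ((1 - η)⁻¹ • z)‖ := norm_le_insert' _ _
      _ ≤ S + ε / 2 := by linarith
  have hint : ∀ q : ℂ × ℂ, ‖q‖ ≤ (1 - η) * R → ‖F q‖ ≤ S + ε / 2 := fun q hq =>
    norm_le_of_forall_torus_le hF.differentiableOn hρ0 hρR htorus hq
  -- approximate `p` by `(1 - η) • p`
  have hp'ρ : ‖(1 - η) • p‖ ≤ (1 - η) * R := by
    rw [norm_smul, Real.norm_eq_abs, abs_of_pos hs0]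
    exact mul_le_mul_of_nonneg_left hp hs0.le
  have hpR : p ∈ closedBall (0 : ℂ × ℂ) R := mem_closedBall_zero_iff.2 hp
  have hp'R : (1 - η) • p ∈ closedBall (0 : ℂ × ℂ) R :=
    mem_closedBall_zero_iff.2 (hp'ρ.trans hρR.le)
  have hdist : dist p ((1 - η) • p) < δ := by
    have h1 : p - (1 - η) • p = η • p := by
      rw [sub_smul, one_smul, sub_sub_cancel]
    rw [dist_eq_norm, h1, norm_smul, Real.norm_eq_abs, abs_of_pos hη0]
    calc η * ‖p‖ ≤ η * R := mul_le_mul_of_nonneg_left hp hη0.le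
      _ < δ := hηδ
  have h1 := hδε p hpR _ hp'R hdist
  rw [dist_eq_norm] at h1
  calc ‖F p‖ ≤ ‖F ((1 - η) • p)‖ + ‖F p - F ((1 - η) • p)‖ := norm_le_insert' _ _
    _ < (S + ε / 2) + ε / 2 := add_lt_add_of_le_of_lt (hint _ hp'ρ) h1
    _ = S + ε := by ring

/-- `|F|_r ≤ X` as soon as `|F| ≤ X` on the torus of radius `r ≥ 0`. [folklore] -/
theorem torusSup_le {F : ℂ × ℂ → ℂ} {r X : ℝ} (hr : 0 ≤ r)
    (h : ∀ z : ℂ × ℂ, ‖z.1‖ = r → ‖z.2‖ = r → ‖F z‖ ≤ X) : torusSup F r ≤ X := by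
  refine csSup_le ⟨‖F ((r : ℂ), (r : ℂ))‖, ((r : ℂ), (r : ℂ)), ⟨by simp [hr], by simp [hr]⟩, rfl⟩ ?_
  rintro _ ⟨z, ⟨hz1, hz2⟩, rfl⟩
  exact h z hz1 hz2

/-! ### Interpolation at well-separated nodes (one variable) -/

/-- One-variable interpolation estimate: if `h` is holomorphic on `|ξ| < Θ`, continuous on
`|ξ| ≤ Θ`, bounded by `M` on `|ξ| = Θ`, has `|h(xᵢ)| ≤ A` at `L` distinct nodes `xᵢ` with
`|xᵢ| ≤ V ≤ Θ/2`, and the Lagrange basis polynomials satisfy `|ℓᵢ(z)| ≤ Λ` at a point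
`|z| ≤ ρ ≤ Θ/2`,
then `|h(z)| ≤ L Λ (A + 2M (V/Θ)^L) + 2M (ρ/Θ)^L` (Taylor polynomial of degree `< L` at `0`, which
is its own Lagrange interpolant, plus Cauchy estimates for the tail; this replaces the kernel
expansion in Roy 2001, Prop. 1). [cite: Roy2001, Prop. 1 (one-variable form)] -/
theorem norm_le_of_interpolation {h : ℂ → ℂ} {Θ M : ℝ} (hΘ : 0 < Θ)
    (hh : DiffContOnCl ℂ h (ball 0 Θ)) (hM : ∀ w ∈ sphere (0 : ℂ) Θ, ‖h w‖ ≤ M)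
    {ι : Type*} [Fintype ι] [DecidableEq ι] {x : ι → ℂ} (hx : Function.Injective x)
    {V A ρ Λ : ℝ} (hV : ∀ i, ‖x i‖ ≤ V) (hVΘ : V ≤ Θ / 2) (hA : ∀ i, ‖h (x i)‖ ≤ A)
    {z : ℂ} (hz : ‖z‖ ≤ ρ) (hρΘ : ρ ≤ Θ / 2)
    (hΛ : ∀ i, ‖(Lagrange.basis Finset.univ x i).eval z‖ ≤ Λ) :
    ‖h z‖ ≤ Fintype.card ι * Λ * (A + 2 * M * (V / Θ) ^ Fintype.card ι) +
      2 * M * (ρ / Θ) ^ Fintype.card ι := by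
  classical
  set L : ℕ := Fintype.card ι with hL
  have hM0 : 0 ≤ M := (norm_nonneg _).trans (hM (Θ : ℂ) (by simp [hΘ.le]))
  -- the Taylor polynomial of degree `< L` at `0`
  set P : Polynomial ℂ := ∑ i : Fin L, Polynomial.C ((((i : ℕ).factorial : ℂ))⁻¹ *
    iteratedDeriv i h 0) * Polynomial.X ^ (i : ℕ) with hP
  have hPeval : ∀ y : ℂ, P.eval y =
      ∑ k ∈ Finset.range L, (k.factorial : ℂ)⁻¹ * (y ^ k * iteratedDeriv k h 0) := by
    intro y
    rw [hP, Polynomial.eval_finsetSum, ← Fin.sum_univ_eq_sum_range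
      (fun k => (k.factorial : ℂ)⁻¹ * (y ^ k * iteratedDeriv k h 0)) L]
    refine Finset.sum_congr rfl fun i _ => ?_
    simp only [Polynomial.eval_mul, Polynomial.eval_C, Polynomial.eval_pow, Polynomial.eval_X]
    ring
  have hPdeg : P.degree < (Finset.univ : Finset ι).card := by
    rw [Finset.card_univ]
    exact Polynomial.degree_sum_fin_lt _
  have htail : ∀ y : ℂ, ‖y‖ ≤ Θ / 2 → ‖h y - P.eval y‖ ≤ 2 * M * (‖y‖ / Θ) ^ L := by
    intro y hy
    rw [hPeval]
    exact norm_sub_taylor_le hΘ hh hM L hy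
  -- `P` is its own Lagrange interpolant at the nodes
  have hint := Lagrange.eq_interpolate (s := Finset.univ) (v := x) (f := P) hx.injOn hPdeg
  have hPz : P.eval z = ∑ i, P.eval (x i) * (Lagrange.basis Finset.univ x i).eval z := by
    conv_lhs => rw [hint]
    rw [Lagrange.interpolate_apply, Polynomial.eval_finsetSum]
    refine Finset.sum_congr rfl fun i _ => ?_
    rw [Polynomial.eval_mul, Polynomial.eval_C]
  have hPnode : ∀ i, ‖P.eval (x i)‖ ≤ A + 2 * M * (V / Θ) ^ L := by
    intro i
    have h1 := htail (x i) ((hV i).trans hVΘ)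
    have h2 : (‖x i‖ / Θ) ^ L ≤ (V / Θ) ^ L :=
      pow_le_pow_left₀ (by positivity) (div_le_div_of_nonneg_right (hV i) hΘ.le) L
    calc ‖P.eval (x i)‖ ≤ ‖h (x i)‖ + ‖h (x i) - P.eval (x i)‖ := norm_le_insert _ _
      _ ≤ A + 2 * M * (‖x i‖ / Θ) ^ L := add_le_add (hA i) h1
      _ ≤ A + 2 * M * (V / Θ) ^ L := by gcongr
  have hhead : ‖P.eval z‖ ≤ L * Λ * (A + 2 * M * (V / Θ) ^ L) := by
    rw [hPz]
    calc ‖∑ i, P.eval (x i) * (Lagrange.basis Finset.univ x i).eval z‖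
        ≤ ∑ i, ‖P.eval (x i) * (Lagrange.basis Finset.univ x i).eval z‖ := norm_sum_le _ _
      _ ≤ ∑ _i : ι, (A + 2 * M * (V / Θ) ^ L) * Λ := by
          refine Finset.sum_le_sum fun i _ => ?_
          rw [norm_mul]
          exact mul_le_mul (hPnode i) (hΛ i) (norm_nonneg _) ((norm_nonneg _).trans (hPnode i))
      _ = L * Λ * (A + 2 * M * (V / Θ) ^ L) := by
          rw [Finset.sum_const, Finset.card_univ, nsmul_eq_mul, ← hL]
          ring
  have hz' : (‖z‖ / Θ) ^ L ≤ (ρ / Θ) ^ L :=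
    pow_le_pow_left₀ (by positivity) (div_le_div_of_nonneg_right hz hΘ.le) L
  calc ‖h z‖ ≤ ‖P.eval z‖ + ‖h z - P.eval z‖ := norm_le_insert' _ _
    _ ≤ L * Λ * (A + 2 * M * (V / Θ) ^ L) + 2 * M * (‖z‖ / Θ) ^ L :=
        add_le_add hhead (htail z (hz.trans hρΘ))
    _ ≤ L * Λ * (A + 2 * M * (V / Θ) ^ L) + 2 * M * (ρ / Θ) ^ L := by gcongr

/-! ### Roy's Lemma 1: the nodes `m + n a` are well separated under condition (2) -/

/-- The combinatorial identity `∏_{0 ≤ m' < N, m' ≠ j} |j - m'| = j! (N-1-j)!`. [folklore] -/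
theorem prod_abs_sub_eq_factorial {N j : ℕ} (hj : j < N) :
    ∏ m' ∈ (Finset.range N).erase j, |(j : ℝ) - m'| = j.factorial * (N - 1 - j).factorial := by
  have hsplit : (Finset.range N).erase j = Finset.range j ∪ Finset.Ico (j + 1) N := by
    ext m'
    simp only [Finset.mem_erase, Finset.mem_range, Finset.mem_union, Finset.mem_Ico]
    omega
  have hdisj : Disjoint (Finset.range j) (Finset.Ico (j + 1) N) := by
    rw [Finset.disjoint_left]
    intro m' h1 h2
    simp only [Finset.mem_range] at h1
    simp only [Finset.mem_Ico] at h2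
    omega
  rw [hsplit, Finset.prod_union hdisj]
  have h1 : ∏ m' ∈ Finset.range j, |(j : ℝ) - m'| = j.factorial := by
    rw [← Finset.prod_range_add_one_eq_factorial, Nat.cast_prod,
      ← Finset.prod_range_reflect (fun i : ℕ => ((i + 1 : ℕ) : ℝ)) j]
    refine Finset.prod_congr rfl fun m' hm' => ?_
    have hm'j : m' < j := Finset.mem_range.1 hm'
    rw [abs_of_nonneg (by
      have : (m' : ℝ) ≤ j := by exact_mod_cast hm'j.le
      linarith)]
    have : j - 1 - m' + 1 = j - m' := by omega
    rw [this, Nat.cast_sub hm'j.le]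
  have h2 : ∏ m' ∈ Finset.Ico (j + 1) N, |(j : ℝ) - m'| = (N - 1 - j).factorial := by
    rw [Finset.prod_Ico_eq_prod_range, ← Finset.prod_range_add_one_eq_factorial, Nat.cast_prod]
    have : N - (j + 1) = N - 1 - j := by omega
    rw [this]
    refine Finset.prod_congr rfl fun k _ => ?_
    rw [abs_of_nonpos (by push_cast; linarith)]
    push_cast
    ring
  rw [h1, h2]

/-- `j! (N-1-j)! ≥ (N-1)!/2^{N-1}` (from `C(N-1, j) ≤ 2^{N-1}`). [folklore] -/
theorem factorial_mul_factorial_ge {N j : ℕ} (hj : j < N) :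
    ((N - 1).factorial : ℝ) / 2 ^ (N - 1) ≤ j.factorial * (N - 1 - j).factorial := by
  have hjN : j ≤ N - 1 := by omega
  have hid := Nat.choose_mul_factorial_mul_factorial hjN
  have hch : (N - 1).choose j ≤ 2 ^ (N - 1) := Nat.choose_le_two_pow _ _
  rw [div_le_iff₀ (by positivity)]
  have : ((N - 1).factorial : ℝ) = (N - 1).choose j * (j.factorial * (N - 1 - j).factorial) := by
    rw [← hid]; push_cast; ring
  rw [this]
  have h0 : (0 : ℝ) ≤ j.factorial * (N - 1 - j).factorial := by positivity
  calc ((N - 1).choose j : ℝ) * (j.factorial * (N - 1 - j).factorial)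
      ≤ (2 : ℝ) ^ (N - 1) * (j.factorial * (N - 1 - j).factorial) := by
        gcongr; exact_mod_cast hch
    _ = j.factorial * (N - 1 - j).factorial * 2 ^ (N - 1) := by ring

/-- `(N-1)! ≥ (N/6)^N`, i.e. `N^N ≤ 6^N (N-1)!` (from `N^N/N! ≤ e^N ≤ 3^N` and `N ≤ 2^N`).
[folklore] -/
theorem pow_self_le_factorial_pred {N : ℕ} (hN : 1 ≤ N) :
    (N : ℝ) ^ N ≤ 6 ^ N * (N - 1).factorial := by
  have h1 : (N : ℝ) ^ N / N.factorial ≤ Real.exp N :=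
    Real.pow_div_factorial_le_exp (N : ℝ) (Nat.cast_nonneg N) N
  have he : Real.exp (N : ℝ) ≤ 3 ^ N := by
    rw [← Real.exp_one_pow]
    exact pow_le_pow_left₀ (Real.exp_pos 1).le Real.exp_one_lt_three.le N
  have h2 : (N : ℝ) ^ N ≤ 3 ^ N * N.factorial := by
    rw [div_le_iff₀ (by positivity)] at h1
    linarith [mul_le_mul_of_nonneg_right he (by positivity : (0 : ℝ) ≤ N.factorial)]
  have h3 : (N.factorial : ℝ) = N * (N - 1).factorial := by
    rw [← Nat.mul_factorial_pred (by omega : N ≠ 0)]; push_cast; ring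
  have h4 : (N : ℝ) ≤ 2 ^ N := by exact_mod_cast (Nat.lt_two_pow_self (n := N)).le
  calc (N : ℝ) ^ N ≤ 3 ^ N * N.factorial := h2
    _ = 3 ^ N * N * (N - 1).factorial := by rw [h3]; ring
    _ ≤ 3 ^ N * 2 ^ N * (N - 1).factorial := by gcongr
    _ = 6 ^ N * (N - 1).factorial := by rw [← mul_pow]; norm_num

/-- Roy 2001, Lemma 1 (one row of the denominator): under condition (2), for fixed `m, n, s`,
`∏_{m' : (m', s) ≠ (m, n)} |(m - m') + (n - s) a| ≥ (N-1)!/8^N` (the real parts of these numbers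
differ by integers; the one nearest to an integer is `≥ 2^{-N}` by (2)). [cite: Roy2001, Lemma 1] -/
theorem roy_row_prod_ge {N : ℕ} (hN : 1 ≤ N) {a : ℂ}
    (h2 : ∀ m n : ℤ, (m ≠ 0 ∨ n ≠ 0) → |m| < N → |n| < N →
      (2 : ℝ) ^ (-(N : ℤ)) ≤ ‖(m : ℂ) + n * a‖)
    (m n s : Fin N) :
    ((N - 1).factorial : ℝ) / 8 ^ N ≤
      ∏ m' ∈ Finset.univ.filter (fun m' : Fin N => (m', s) ≠ (m, n)),
        ‖(((m : ℕ) : ℂ) - ((m' : ℕ) : ℂ)) + (((n : ℕ) : ℂ) - ((s : ℕ) : ℂ)) * a‖ := by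
  classical
  -- the factor and its real part
  set f : Fin N → ℂ := fun m' =>
    (((m : ℕ) : ℂ) - ((m' : ℕ) : ℂ)) + (((n : ℕ) : ℂ) - ((s : ℕ) : ℂ)) * a with hf
  set c : ℝ := (m : ℕ) + (((n : ℕ) : ℝ) - (s : ℕ)) * a.re with hc
  have hre : ∀ m' : Fin N, (f m').re = c - (m' : ℕ) := by
    intro m'; simp only [hf, hc, add_re, sub_re, mul_re, natCast_re, natCast_im, sub_im,
      sub_self, zero_mul, sub_zero]; ring
  -- nearest integer and its clamp to `[0, N-1]`
  set j₀ : ℤ := round c with hj₀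
  have hcj₀ : |c - j₀| ≤ 1 / 2 := abs_sub_round c
  set j₁ : ℤ := max 0 (min j₀ ((N : ℤ) - 1)) with hj₁
  have hj₁0 : 0 ≤ j₁ := le_max_left _ _
  have hj₁N : j₁ ≤ (N : ℤ) - 1 := max_le (by omega) (min_le_right _ _)
  obtain ⟨j, hj⟩ : ∃ j : Fin N, ((j : ℕ) : ℤ) = j₁ :=
    ⟨⟨j₁.toNat, by omega⟩, by simp only; omega⟩
  have hclamp : ∀ m' : Fin N, |(j : ℕ) - ((m' : ℕ) : ℝ)| ≤ |(j₀ : ℝ) - ((m' : ℕ) : ℝ)| := by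
    intro m'
    have hm' : ((m' : ℕ) : ℤ) < N := by exact_mod_cast m'.is_lt
    have key : |((j : ℕ) : ℤ) - ((m' : ℕ) : ℤ)| ≤ |j₀ - ((m' : ℕ) : ℤ)| := by
      rw [hj, hj₁]
      rcases le_or_gt j₀ 0 with h0 | h0
      · rw [show max 0 (min j₀ ((N : ℤ) - 1)) = 0 by
          rw [max_eq_left]; exact le_trans (min_le_left _ _) h0]
        rw [abs_le]; constructor <;> cases abs_cases (j₀ - ((m' : ℕ) : ℤ)) <;> omega
      rcases le_or_gt j₀ ((N : ℤ) - 1) with h1 | h1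
      · rw [show max 0 (min j₀ ((N : ℤ) - 1)) = j₀ by
          rw [min_eq_left h1, max_eq_right h0.le]]
      · rw [show max 0 (min j₀ ((N : ℤ) - 1)) = (N : ℤ) - 1 by
          rw [min_eq_right h1.le, max_eq_right (by omega)]]
        rw [abs_le]; constructor <;> cases abs_cases (j₀ - ((m' : ℕ) : ℤ)) <;> omega
    have e1 : |(j : ℕ) - ((m' : ℕ) : ℝ)| = ((|((j : ℕ) : ℤ) - ((m' : ℕ) : ℤ)| : ℤ) : ℝ) := by
      push_cast; rfl
    have e2 : |(j₀ : ℝ) - ((m' : ℕ) : ℝ)| = ((|j₀ - ((m' : ℕ) : ℤ)| : ℤ) : ℝ) := by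
      push_cast; rfl
    rw [e1, e2]
    exact_mod_cast key
  -- lower bound for the factors away from `j`
  have hfar : ∀ m' : Fin N, m' ≠ j → |(j : ℕ) - ((m' : ℕ) : ℝ)| / 2 ≤ ‖f m'‖ := by
    intro m' hm'
    have hjm : (1 : ℝ) ≤ |(j : ℕ) - ((m' : ℕ) : ℝ)| := by
      have : ((j : ℕ) : ℤ) ≠ ((m' : ℕ) : ℤ) := by
        intro h; apply hm'; ext; exact_mod_cast h.symm
      have h1 : (1 : ℤ) ≤ |((j : ℕ) : ℤ) - ((m' : ℕ) : ℤ)| := Int.one_le_abs (sub_ne_zero.2 this)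
      have e1 : |(j : ℕ) - ((m' : ℕ) : ℝ)| = ((|((j : ℕ) : ℤ) - ((m' : ℕ) : ℤ)| : ℤ) : ℝ) := by
        push_cast; rfl
      rw [e1]; exact_mod_cast h1
    have hrele : |(f m').re| ≤ ‖f m'‖ := Complex.abs_re_le_norm _
    rw [hre] at hrele
    have : |(j₀ : ℝ) - ((m' : ℕ) : ℝ)| - 1 / 2 ≤ |c - (m' : ℕ)| := by
      have := abs_sub_abs_le_abs_sub ((j₀ : ℝ) - ((m' : ℕ) : ℝ)) (c - (m' : ℕ))
      rw [show (j₀ : ℝ) - ((m' : ℕ) : ℝ) - (c - (m' : ℕ)) = -(c - j₀) by ring, abs_neg] at this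
      linarith
    linarith [hclamp m']
  -- lower bound `2^{-N}` for every factor with `(m', s) ≠ (m, n)`, from condition (2)
  have hall : ∀ m' : Fin N, (m', s) ≠ (m, n) → (2 : ℝ) ^ (-(N : ℤ)) ≤ ‖f m'‖ := by
    intro m' hm'
    have hmN := m.is_lt; have hm'N := m'.is_lt; have hnN := n.is_lt; have hsN := s.is_lt
    have hne : ((m : ℕ) : ℤ) - ((m' : ℕ) : ℤ) ≠ 0 ∨ ((n : ℕ) : ℤ) - ((s : ℕ) : ℤ) ≠ 0 := by
      by_contra hcon
      simp only [not_or, not_not] at hcon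
      apply hm'
      have h1 : (m' : ℕ) = (m : ℕ) := by omega
      have h2 : (s : ℕ) = (n : ℕ) := by omega
      rw [Prod.mk.injEq]
      exact ⟨Fin.ext h1, Fin.ext h2⟩
    have h := h2 (((m : ℕ) : ℤ) - ((m' : ℕ) : ℤ)) (((n : ℕ) : ℤ) - ((s : ℕ) : ℤ)) hne
      (by rw [abs_lt]; constructor <;> omega) (by rw [abs_lt]; constructor <;> omega)
    have e : ((((m : ℕ) : ℤ) - ((m' : ℕ) : ℤ) : ℤ) : ℂ) +
        ((((n : ℕ) : ℤ) - ((s : ℕ) : ℤ) : ℤ) : ℂ) * a = f m' := by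
      simp only [hf]; push_cast; ring
    rwa [e] at h
  -- when `s = n` the clamped nearest integer is `m` itself
  have hjm : s = n → j = m := by
    intro hsn
    have hc' : c = (m : ℕ) := by rw [hc, hsn]; ring
    have hj₀' : j₀ = (m : ℕ) := by rw [hj₀, hc']; exact_mod_cast round_natCast (m : ℕ)
    have hmN : ((m : ℕ) : ℤ) ≤ (N : ℤ) - 1 := by have := m.is_lt; omega
    have : j₁ = (m : ℕ) := by
      rw [hj₁, hj₀', min_eq_left hmN, max_eq_right (by positivity)]
    ext; exact_mod_cast (hj.trans this)
  -- the minorant `g`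
  set g : Fin N → ℝ := fun m' =>
    if m' = j then (2 : ℝ) ^ (-(N : ℤ)) else |(j : ℕ) - ((m' : ℕ) : ℝ)| / 2 with hg
  have hg_le : ∀ m' ∈ Finset.univ.filter (fun m' : Fin N => (m', s) ≠ (m, n)), g m' ≤ ‖f m'‖ := by
    intro m' hm'
    rw [Finset.mem_filter] at hm'
    by_cases hmj : m' = j
    · simp only [hg, hmj, if_true]; exact hall j (hmj ▸ hm'.2)
    · simp only [hg, hmj, if_false]; exact hfar m' hmj
  have hg_nonneg : ∀ m' : Fin N, 0 ≤ g m' := by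
    intro m'; simp only [hg]; split_ifs <;> positivity
  have hg_le_one_off : ∀ m' ∈ Finset.univ.filter (fun m' : Fin N => ¬ (m', s) ≠ (m, n)),
      g m' ≤ 1 := by
    intro m' hm'
    rw [Finset.mem_filter, not_not, Prod.mk.injEq] at hm'
    have : m' = j := by rw [hjm hm'.2.2, hm'.2.1]
    simp only [hg, this, if_true]
    exact zpow_le_one_of_nonpos₀ (by norm_num) (by omega)
  -- ∏ over the filter ≥ ∏ over everything
  have hprod_univ : ∏ m' : Fin N, g m' ≤
      ∏ m' ∈ Finset.univ.filter (fun m' : Fin N => (m', s) ≠ (m, n)), g m' := by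
    rw [← Finset.prod_filter_mul_prod_filter_not Finset.univ (fun m' : Fin N => (m', s) ≠ (m, n))]
    have h1 : ∏ m' ∈ Finset.univ.filter (fun m' : Fin N => ¬ (m', s) ≠ (m, n)), g m' ≤ 1 :=
      Finset.prod_le_one (fun m' _ => hg_nonneg m') hg_le_one_off
    have h0 : 0 ≤ ∏ m' ∈ Finset.univ.filter (fun m' : Fin N => (m', s) ≠ (m, n)), g m' :=
      Finset.prod_nonneg fun m' _ => hg_nonneg m'
    calc _ ≤ (∏ m' ∈ Finset.univ.filter (fun m' : Fin N => (m', s) ≠ (m, n)), g m') * 1 := by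
          gcongr
      _ = _ := mul_one _
  -- evaluate ∏ g
  have hprod_g : ∏ m' : Fin N, g m' =
      (2 : ℝ) ^ (-(N : ℤ)) * ∏ m' ∈ Finset.univ.erase j, |(j : ℕ) - ((m' : ℕ) : ℝ)| / 2 := by
    rw [← Finset.mul_prod_erase Finset.univ g (Finset.mem_univ j)]
    congr 1
    · simp [hg]
    · refine Finset.prod_congr rfl fun m' hm' => ?_
      simp only [hg, (Finset.mem_erase.1 hm').1, if_false]
  have hprod_abs : ∏ m' ∈ Finset.univ.erase j, |(j : ℕ) - ((m' : ℕ) : ℝ)| / 2 =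
      (∏ m' ∈ (Finset.range N).erase (j : ℕ), |((j : ℕ) : ℝ) - m'|) / 2 ^ (N - 1) := by
    rw [Finset.prod_div_distrib, Finset.prod_const, Finset.card_erase_of_mem (Finset.mem_univ j),
      Finset.card_univ, Fintype.card_fin]
    congr 1
    rw [← Finset.filter_ne', Finset.prod_filter, ← Finset.filter_ne', Finset.prod_filter]
    have e : (∏ m' : Fin N, if m' ≠ j then |((j : ℕ) : ℝ) - ((m' : ℕ) : ℝ)| else 1) =
        ∏ m' : Fin N, (fun k : ℕ => if k ≠ (j : ℕ) then |((j : ℕ) : ℝ) - k| else 1) (m' : ℕ) := by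
      refine Finset.prod_congr rfl fun m' _ => ?_
      simp only [ne_eq, Fin.ext_iff]
    rw [e]
    exact Fin.prod_univ_eq_prod_range
      (fun k : ℕ => if k ≠ (j : ℕ) then |((j : ℕ) : ℝ) - k| else 1) N
  have hcomb := prod_abs_sub_eq_factorial j.is_lt
  have hfact := factorial_mul_factorial_ge j.is_lt
  -- assemble
  have hprod_f : ∏ m' ∈ Finset.univ.filter (fun m' : Fin N => (m', s) ≠ (m, n)), g m' ≤
      ∏ m' ∈ Finset.univ.filter (fun m' : Fin N => (m', s) ≠ (m, n)), ‖f m'‖ :=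
    Finset.prod_le_prod (fun m' _ => hg_nonneg m') hg_le
  have hpow : (2 : ℝ) ^ N * (2 ^ (N - 1) * 2 ^ (N - 1)) = 2 ^ (3 * N - 2) := by
    rw [← pow_add, ← pow_add]; congr 1; omega
  have h8 : (8 : ℝ) ^ N = 2 ^ 2 * 2 ^ (3 * N - 2) := by
    rw [← pow_add, show (8 : ℝ) = 2 ^ 3 by norm_num, ← pow_mul]; congr 1; omega
  calc ((N - 1).factorial : ℝ) / 8 ^ N
      ≤ ((N - 1).factorial : ℝ) / 2 ^ (3 * N - 2) :=
        div_le_div_of_nonneg_left (by positivity) (by positivity)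
          (by rw [h8]; linarith [pow_pos (two_pos : (0 : ℝ) < 2) (3 * N - 2)])
    _ = (2 : ℝ) ^ (-(N : ℤ)) * ((((N - 1).factorial : ℝ) / 2 ^ (N - 1)) / 2 ^ (N - 1)) := by
        rw [zpow_neg, zpow_natCast, ← hpow]
        field_simp
    _ ≤ (2 : ℝ) ^ (-(N : ℤ)) *
        ((((j : ℕ).factorial : ℝ) * ((N - 1 - (j : ℕ)).factorial : ℝ)) / 2 ^ (N - 1)) := by
        gcongr
    _ = ∏ m' : Fin N, g m' := by rw [hprod_g, hprod_abs, hcomb]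
    _ ≤ ∏ m' ∈ Finset.univ.filter (fun m' : Fin N => (m', s) ≠ (m, n)), g m' := hprod_univ
    _ ≤ _ := hprod_f

/-- Roy 2001, Lemma 1 (the denominator of the Lagrange basis polynomial at the node `i`):
`∏_{j ≠ i} |x_i - x_j| ≥ ((N-1)!/8^N)^N` for the nodes `x_{(m,n)} = m + n a`, `0 ≤ m, n < N`,
under condition (2). [cite: Roy2001, Lemma 1] -/
theorem roy_denominator_ge {N : ℕ} (hN : 1 ≤ N) {a : ℂ}
    (h2 : ∀ m n : ℤ, (m ≠ 0 ∨ n ≠ 0) → |m| < N → |n| < N →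
      (2 : ℝ) ^ (-(N : ℤ)) ≤ ‖(m : ℂ) + n * a‖)
    {x : Fin N × Fin N → ℂ} (hx : ∀ j, x j = ((j.1 : ℕ) : ℂ) + ((j.2 : ℕ) : ℂ) * a)
    (i : Fin N × Fin N) :
    (((N - 1).factorial : ℝ) / 8 ^ N) ^ N ≤ ∏ j ∈ Finset.univ.erase i, ‖x i - x j‖ := by
  classical
  obtain ⟨m, n⟩ := i
  have hsplit : ∏ j ∈ Finset.univ.erase (m, n), ‖x (m, n) - x j‖ =
      ∏ s : Fin N, ∏ m' ∈ Finset.univ.filter (fun m' : Fin N => (m', s) ≠ (m, n)),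
        ‖x (m, n) - x (m', s)‖ := by
    rw [← Finset.filter_ne', Finset.prod_filter, Fintype.prod_prod_type, Finset.prod_comm]
    refine Finset.prod_congr rfl fun s _ => ?_
    rw [Finset.prod_filter]
  rw [hsplit]
  calc (((N - 1).factorial : ℝ) / 8 ^ N) ^ N = ∏ _s : Fin N, ((N - 1).factorial : ℝ) / 8 ^ N := by
        rw [Finset.prod_const, Finset.card_univ, Fintype.card_fin]
    _ ≤ _ := Finset.prod_le_prod (fun _ _ => by positivity) fun s _ => ?_
  have hrow := roy_row_prod_ge hN h2 m n s
  refine hrow.trans (le_of_eq (Finset.prod_congr rfl fun m' _ => ?_))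
  rw [hx, hx]
  congr 1
  simp only
  ring

/-- The nodes `m + n a` lie in the disc of radius `(1 + |a|) N`. [cite: Roy2001, Lemma 1] -/
theorem roy_node_norm_le {N : ℕ} {a : ℂ} {x : Fin N × Fin N → ℂ}
    (hx : ∀ j, x j = ((j.1 : ℕ) : ℂ) + ((j.2 : ℕ) : ℂ) * a) (j : Fin N × Fin N) :
    ‖x j‖ ≤ (1 + ‖a‖) * N := by
  rw [hx]
  have h1 : ((j.1 : ℕ) : ℝ) ≤ N := by exact_mod_cast j.1.is_lt.le
  have h2 : ((j.2 : ℕ) : ℝ) ≤ N := by exact_mod_cast j.2.is_lt.le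
  calc ‖((j.1 : ℕ) : ℂ) + ((j.2 : ℕ) : ℂ) * a‖ ≤ ‖((j.1 : ℕ) : ℂ)‖ + ‖((j.2 : ℕ) : ℂ) * a‖ :=
        norm_add_le _ _
    _ = (j.1 : ℕ) + (j.2 : ℕ) * ‖a‖ := by rw [norm_mul, Complex.norm_natCast, Complex.norm_natCast]
    _ ≤ N + N * ‖a‖ := by gcongr
    _ = (1 + ‖a‖) * N := by ring

/-- Under condition (2) the nodes `m + n a`, `0 ≤ m, n < N`, are pairwise distinct.
[cite: Roy2001, Lemma 1] -/
theorem roy_node_injective {N : ℕ} {a : ℂ}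
    (h2 : ∀ m n : ℤ, (m ≠ 0 ∨ n ≠ 0) → |m| < N → |n| < N →
      (2 : ℝ) ^ (-(N : ℤ)) ≤ ‖(m : ℂ) + n * a‖)
    {x : Fin N × Fin N → ℂ} (hx : ∀ j, x j = ((j.1 : ℕ) : ℂ) + ((j.2 : ℕ) : ℂ) * a) :
    Function.Injective x := by
  intro i j hij
  by_contra hne
  have hm := i.1.is_lt; have hm' := j.1.is_lt; have hn := i.2.is_lt; have hn' := j.2.is_lt
  have hne' : ((i.1 : ℕ) : ℤ) - ((j.1 : ℕ) : ℤ) ≠ 0 ∨ ((i.2 : ℕ) : ℤ) - ((j.2 : ℕ) : ℤ) ≠ 0 := by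
    by_contra hcon
    simp only [not_or, not_not] at hcon
    apply hne
    have e1 : (i.1 : ℕ) = (j.1 : ℕ) := by omega
    have e2 : (i.2 : ℕ) = (j.2 : ℕ) := by omega
    exact Prod.ext (Fin.ext e1) (Fin.ext e2)
  have h := h2 _ _ hne' (by rw [abs_lt]; constructor <;> omega)
    (by rw [abs_lt]; constructor <;> omega)
  have e : ((((i.1 : ℕ) : ℤ) - ((j.1 : ℕ) : ℤ) : ℤ) : ℂ) +
      ((((i.2 : ℕ) : ℤ) - ((j.2 : ℕ) : ℤ) : ℤ) : ℂ) * a = x i - x j := by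
    rw [hx, hx]; push_cast; ring
  rw [e, hij, sub_self, norm_zero] at h
  exact absurd h (not_le.2 (by positivity))

/-- Roy 2001, Lemma 1 in the form needed here: under condition (2), the Lagrange basis
polynomials `ℓ_i` for the `N²` nodes `m + n a` satisfy `|ℓ_i(z)| ≤ (48 (ρ + (1+|a|) N)/N)^{N²}`
for `|z| ≤ ρ`. [cite: Roy2001, Lemma 1] -/
theorem roy_lagrange_basis_le {N : ℕ} (hN : 1 ≤ N) {a : ℂ}
    (h2 : ∀ m n : ℤ, (m ≠ 0 ∨ n ≠ 0) → |m| < N → |n| < N →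
      (2 : ℝ) ^ (-(N : ℤ)) ≤ ‖(m : ℂ) + n * a‖)
    {x : Fin N × Fin N → ℂ} (hx : ∀ j, x j = ((j.1 : ℕ) : ℂ) + ((j.2 : ℕ) : ℂ) * a)
    {ρ : ℝ} (hρ : 0 ≤ ρ) {z : ℂ} (hz : ‖z‖ ≤ ρ) (i : Fin N × Fin N) :
    ‖(Lagrange.basis Finset.univ x i).eval z‖ ≤ (48 * (ρ + (1 + ‖a‖) * N) / N) ^ (N ^ 2) := by
  classical
  have hNpos : (0 : ℝ) < N := by exact_mod_cast hN
  set V : ℝ := (1 + ‖a‖) * N with hV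
  have hVj : ∀ j, ‖x j‖ ≤ V := roy_node_norm_le hx
  have hV1 : 1 ≤ V := by
    rw [hV]
    have : (1 : ℝ) ≤ N := by exact_mod_cast hN
    nlinarith [norm_nonneg a]
  have hρV1 : 1 ≤ ρ + V := by linarith
  rw [Lagrange.basis, Polynomial.eval_prod, norm_prod]
  simp only [Lagrange.basisDivisor, Polynomial.eval_mul, Polynomial.eval_C, Polynomial.eval_sub,
    Polynomial.eval_X, norm_mul, norm_inv]
  rw [Finset.prod_mul_distrib, Finset.prod_inv_distrib]
  have hcard : (Finset.univ.erase i).card = N ^ 2 - 1 := by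
    rw [Finset.card_erase_of_mem (Finset.mem_univ _), Finset.card_univ, Fintype.card_prod,
      Fintype.card_fin, sq]
  have hnum : ∏ j ∈ Finset.univ.erase i, ‖z - x j‖ ≤ (ρ + V) ^ (N ^ 2 - 1) := by
    calc ∏ j ∈ Finset.univ.erase i, ‖z - x j‖ ≤ ∏ _j ∈ Finset.univ.erase i, (ρ + V) :=
          Finset.prod_le_prod (fun _ _ => norm_nonneg _) fun j _ =>
            (norm_sub_le _ _).trans (add_le_add hz (hVj j))
      _ = (ρ + V) ^ (N ^ 2 - 1) := by rw [Finset.prod_const, hcard]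
  have hden := roy_denominator_ge hN h2 hx i
  have hd0 : (0 : ℝ) < (((N - 1).factorial : ℝ) / 8 ^ N) ^ N := by positivity
  have hfac := pow_self_le_factorial_pred hN
  -- `(8^N/(N-1)!)^N ≤ (48/N)^{N N}`
  have hkey : ((((N - 1).factorial : ℝ) / 8 ^ N) ^ N)⁻¹ ≤ ((48 / (N : ℝ)) ^ N) ^ N := by
    rw [← inv_pow]
    refine pow_le_pow_left₀ (by positivity) ?_ N
    rw [inv_div, div_le_iff₀ (by positivity), div_pow, div_mul_eq_mul_div,
      le_div_iff₀ (by positivity)]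
    calc (8 : ℝ) ^ N * (N : ℝ) ^ N ≤ 8 ^ N * (6 ^ N * (N - 1).factorial) := by gcongr
      _ = 48 ^ N * (N - 1).factorial := by rw [← mul_assoc, ← mul_pow]; norm_num
  calc (∏ j ∈ Finset.univ.erase i, ‖x i - x j‖)⁻¹ * ∏ j ∈ Finset.univ.erase i, ‖z - x j‖
      ≤ ((((N - 1).factorial : ℝ) / 8 ^ N) ^ N)⁻¹ * (ρ + V) ^ (N ^ 2 - 1) :=
        mul_le_mul (inv_anti₀ hd0 hden) hnum (Finset.prod_nonneg fun _ _ => norm_nonneg _)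
          (inv_nonneg.2 hd0.le)
    _ ≤ ((48 / (N : ℝ)) ^ N) ^ N * (ρ + V) ^ (N ^ 2) := by
        gcongr
        exact Nat.sub_le _ _
    _ = (48 * (ρ + V) / N) ^ (N ^ 2) := by
        rw [← pow_mul, ← sq, ← mul_pow]
        congr 1
        field_simp

/-! ### Linear algebra in `ℂ²` -/

/-- Two linearly independent vectors of `ℂ²` have non-zero determinant. [folklore] -/
theorem det_ne_zero_of_linearIndependent {u w : ℂ × ℂ} (h : LinearIndependent ℂ ![u, w]) :
    u.1 * w.2 - u.2 * w.1 ≠ 0 := by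
  intro hdet
  rw [LinearIndependent.pair_iff] at h
  obtain ⟨h1, h2⟩ := h w.2 (-u.2) (by
    ext
    · simp only [Prod.fst_add, Prod.smul_fst, smul_eq_mul, Prod.fst_zero]; linear_combination hdet
    · simp only [Prod.snd_add, Prod.smul_snd, smul_eq_mul, Prod.snd_zero]; ring)
  have hu2 : u.2 = 0 := neg_eq_zero.1 h2
  obtain ⟨h3, h4⟩ := h w.1 (-u.1) (by
    ext
    · simp only [Prod.fst_add, Prod.smul_fst, smul_eq_mul, Prod.fst_zero]; ring
    · simp only [Prod.snd_add, Prod.smul_snd, smul_eq_mul, Prod.snd_zero, h1, hu2]; ring)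
  have hu1 : u.1 = 0 := neg_eq_zero.1 h4
  have := (h 1 0 (by ext <;> simp [hu1, hu2])).1
  exact one_ne_zero this

/-- Coordinates with respect to a basis `{u, w}` of `ℂ²` (Cramer's rule) and their size:
`p = z u + ω w` with `|z|, |ω| ≤ 2 (‖u‖ + ‖w‖) ‖p‖ / |det(u, w)|`. [folklore] -/
theorem exists_coords {u w : ℂ × ℂ} (hdet : u.1 * w.2 - u.2 * w.1 ≠ 0) (p : ℂ × ℂ) :
    ∃ z ω : ℂ, p = z • u + ω • w ∧
      ‖z‖ ≤ 2 * (‖u‖ + ‖w‖) / ‖u.1 * w.2 - u.2 * w.1‖ * ‖p‖ ∧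
      ‖ω‖ ≤ 2 * (‖u‖ + ‖w‖) / ‖u.1 * w.2 - u.2 * w.1‖ * ‖p‖ := by
  set d : ℂ := u.1 * w.2 - u.2 * w.1 with hd
  have hdpos : 0 < ‖d‖ := norm_pos_iff.2 hdet
  refine ⟨(p.1 * w.2 - p.2 * w.1) / d, (u.1 * p.2 - u.2 * p.1) / d, ?_, ?_, ?_⟩
  · ext
    · simp only [Prod.fst_add, Prod.smul_fst, smul_eq_mul]
      field_simp
      ring
    · simp only [Prod.snd_add, Prod.smul_snd, smul_eq_mul]
      field_simp
      ring
  · have h1 : ‖p.1 * w.2 - p.2 * w.1‖ ≤ ‖p‖ * ‖w‖ + ‖p‖ * ‖w‖ := by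
      calc ‖p.1 * w.2 - p.2 * w.1‖ ≤ ‖p.1 * w.2‖ + ‖p.2 * w.1‖ := norm_sub_le _ _
        _ = ‖p.1‖ * ‖w.2‖ + ‖p.2‖ * ‖w.1‖ := by rw [norm_mul, norm_mul]
        _ ≤ ‖p‖ * ‖w‖ + ‖p‖ * ‖w‖ :=
          add_le_add (mul_le_mul (norm_fst_le p) (norm_snd_le w) (norm_nonneg _) (norm_nonneg _))
            (mul_le_mul (norm_snd_le p) (norm_fst_le w) (norm_nonneg _) (norm_nonneg _))
    have h2 : ‖p.1 * w.2 - p.2 * w.1‖ ≤ 2 * (‖u‖ + ‖w‖) * ‖p‖ := by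
      nlinarith [norm_nonneg u, norm_nonneg p]
    rw [norm_div, show 2 * (‖u‖ + ‖w‖) / ‖d‖ * ‖p‖ = (2 * (‖u‖ + ‖w‖) * ‖p‖) / ‖d‖ by ring]
    exact div_le_div_of_nonneg_right h2 hdpos.le
  · have h1 : ‖u.1 * p.2 - u.2 * p.1‖ ≤ ‖u‖ * ‖p‖ + ‖u‖ * ‖p‖ := by
      calc ‖u.1 * p.2 - u.2 * p.1‖ ≤ ‖u.1 * p.2‖ + ‖u.2 * p.1‖ := norm_sub_le _ _
        _ = ‖u.1‖ * ‖p.2‖ + ‖u.2‖ * ‖p.1‖ := by rw [norm_mul, norm_mul]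
        _ ≤ ‖u‖ * ‖p‖ + ‖u‖ * ‖p‖ :=
          add_le_add (mul_le_mul (norm_fst_le u) (norm_snd_le p) (norm_nonneg _) (norm_nonneg _))
            (mul_le_mul (norm_snd_le u) (norm_fst_le p) (norm_nonneg _) (norm_nonneg _))
    have h2 : ‖u.1 * p.2 - u.2 * p.1‖ ≤ 2 * (‖u‖ + ‖w‖) * ‖p‖ := by
      nlinarith [norm_nonneg w, norm_nonneg p]
    rw [norm_div, show 2 * (‖u‖ + ‖w‖) / ‖d‖ * ‖p‖ = (2 * (‖u‖ + ‖w‖) * ‖p‖) / ‖d‖ by ring]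
    exact div_le_div_of_nonneg_right h2 hdpos.le

/-! ### Numerical bookkeeping -/

/-- `L³ ≤ 8^L`. [folklore] -/
theorem cube_le_eight_pow (L : ℕ) : L ^ 3 ≤ 8 ^ L := by
  have h : L < 2 ^ L := Nat.lt_two_pow_self
  calc L ^ 3 ≤ (2 ^ L) ^ 3 := Nat.pow_le_pow_left h.le 3
    _ = 8 ^ L := by rw [← pow_mul, mul_comm, pow_mul]; norm_num

/-- `4L² + 2L + 2 ≤ 8^L` for `L ≥ 1`. [folklore] -/
theorem quad_le_eight_pow {L : ℕ} (hL : 1 ≤ L) : 4 * L ^ 2 + 2 * L + 2 ≤ 8 ^ L := by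
  induction L, hL using Nat.le_induction with
  | base => norm_num
  | succ k hk ih =>
    have : 4 * (k + 1) ^ 2 + 2 * (k + 1) + 2 ≤ 8 * (4 * k ^ 2 + 2 * k + 2) := by nlinarith
    calc 4 * (k + 1) ^ 2 + 2 * (k + 1) + 2 ≤ 8 * (4 * k ^ 2 + 2 * k + 2) := this
      _ ≤ 8 * 8 ^ k := by omega
      _ = 8 ^ (k + 1) := by ring

set_option maxHeartbeats 400000 in
/-- The final bookkeeping of constants in the proof of Theorem 2 (pure real arithmetic):
with `Y = X ν`, `P, Q ≥ 1`, `0 ≤ gᵢ ≤ G`, `8 P Q ≤ c` and `8 P Q G ≤ c`,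
`L X^L (L P^L (L Q^L B + 2M (g₁ν)^L + 2M (g₂ν)^L) + 2M (g₃ν)^L) + 2M Y^L ≤ (cX)^L B + (cY)^L M`.
[cite: Roy2001, §3 (proof of Thm. 2, choice of c)] -/
theorem thm2_bookkeeping {L : ℕ} (hL : 1 ≤ L) {B M X Y ν P Q g₁ g₂ g₃ G c : ℝ}
    (hB : 0 ≤ B) (hM : 0 ≤ M) (hX : 0 ≤ X) (hY : 0 ≤ Y) (hν : 0 ≤ ν) (hXν : X * ν = Y)
    (hP : 1 ≤ P) (hQ : 1 ≤ Q) (hg₁ : 0 ≤ g₁) (hg₂ : 0 ≤ g₂) (hg₃ : 0 ≤ g₃)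
    (hg₁G : g₁ ≤ G) (hg₂G : g₂ ≤ G) (hg₃G : g₃ ≤ G)
    (hc1 : 8 * (P * Q) ≤ c) (hc2 : 8 * (P * Q * G) ≤ c) :
    L * X ^ L * (L * P ^ L * (L * Q ^ L * B + 2 * M * (g₁ * ν) ^ L + 2 * M * (g₂ * ν) ^ L)
        + 2 * M * (g₃ * ν) ^ L) + 2 * M * Y ^ L ≤
      (c * X) ^ L * B + (c * Y) ^ L * M := by
  have hL0 : (0 : ℝ) < L := by exact_mod_cast hL
  have hG : 0 ≤ G := hg₁.trans hg₁G
  have hPQ1 : 1 ≤ P * Q := one_le_mul_of_one_le_of_one_le hP hQ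
  have hc8 : 1 ≤ c / 8 := by rw [le_div_iff₀ (by norm_num)]; linarith
  have hc0 : 0 ≤ c := by linarith
  -- monomial bounds
  have e8 : (8 : ℝ) ^ L * (c / 8) ^ L = c ^ L := by rw [← mul_pow]; congr 1; ring
  have hL3 : (L : ℝ) ^ 3 ≤ 8 ^ L := by exact_mod_cast cube_le_eight_pow L
  have hL2 : 4 * (L : ℝ) ^ 2 + 2 * L + 2 ≤ 8 ^ L := by exact_mod_cast quad_le_eight_pow hL
  -- T1
  have hT1 : L * X ^ L * (L * P ^ L * (L * Q ^ L * B)) ≤ (c * X) ^ L * B := by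
    have h1 : (P * Q * X) ^ L ≤ (c / 8 * X) ^ L :=
      pow_le_pow_left₀ (by positivity) (by nlinarith) L
    calc L * X ^ L * (L * P ^ L * (L * Q ^ L * B)) = (L : ℝ) ^ 3 * (P * Q * X) ^ L * B := by ring
      _ ≤ 8 ^ L * (c / 8 * X) ^ L * B := by gcongr
      _ = (c * X) ^ L * B := by rw [mul_pow (c / 8), ← mul_assoc, e8, mul_pow]
  -- the `Y`-terms
  have hGY : ∀ g : ℝ, 0 ≤ g → g ≤ G → ∀ A : ℝ, 0 ≤ A → A * G ≤ c / 8 →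
      A ^ L * (X ^ L * (g * ν) ^ L) ≤ (c / 8 * Y) ^ L := by
    intro g hg0 hgG A hA hAG
    rw [← mul_pow, ← mul_pow]
    refine pow_le_pow_left₀ (by positivity) ?_ L
    calc A * (X * (g * ν)) = (A * g) * (X * ν) := by ring
      _ ≤ (c / 8) * Y := by
          rw [hXν]
          exact mul_le_mul_of_nonneg_right ((mul_le_mul_of_nonneg_left hgG hA).trans hAG) hY
  have hPG0 : 0 ≤ P * G := by positivity
  have hPG : P * G ≤ c / 8 := by
    have : P * G ≤ P * Q * G := by nlinarith [mul_nonneg hPG0 (sub_nonneg.2 hQ)]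
    linarith [this, hc2]
  have h1G : 1 * G ≤ c / 8 := by nlinarith [mul_nonneg hG (sub_nonneg.2 hPQ1)]
  have hT2 : L * X ^ L * (L * P ^ L * (2 * M * (g₁ * ν) ^ L)) ≤
      2 * L ^ 2 * ((c / 8 * Y) ^ L * M) := by
    have := hGY g₁ hg₁ hg₁G P (by linarith) hPG
    calc L * X ^ L * (L * P ^ L * (2 * M * (g₁ * ν) ^ L))
        = 2 * L ^ 2 * ((P ^ L * (X ^ L * (g₁ * ν) ^ L)) * M) := by ring
      _ ≤ 2 * L ^ 2 * ((c / 8 * Y) ^ L * M) := by gcongr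
  have hT3 : L * X ^ L * (L * P ^ L * (2 * M * (g₂ * ν) ^ L)) ≤
      2 * L ^ 2 * ((c / 8 * Y) ^ L * M) := by
    have := hGY g₂ hg₂ hg₂G P (by linarith) hPG
    calc L * X ^ L * (L * P ^ L * (2 * M * (g₂ * ν) ^ L))
        = 2 * L ^ 2 * ((P ^ L * (X ^ L * (g₂ * ν) ^ L)) * M) := by ring
      _ ≤ 2 * L ^ 2 * ((c / 8 * Y) ^ L * M) := by gcongr
  have hT4 : L * X ^ L * (2 * M * (g₃ * ν) ^ L) ≤ 2 * L * ((c / 8 * Y) ^ L * M) := by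
    have := hGY g₃ hg₃ hg₃G 1 zero_le_one h1G
    rw [one_pow, one_mul] at this
    calc L * X ^ L * (2 * M * (g₃ * ν) ^ L) = 2 * L * ((X ^ L * (g₃ * ν) ^ L) * M) := by ring
      _ ≤ 2 * L * ((c / 8 * Y) ^ L * M) := by gcongr
  have hT5 : 2 * M * Y ^ L ≤ 2 * ((c / 8 * Y) ^ L * M) := by
    have : Y ^ L ≤ (c / 8 * Y) ^ L := by
      refine pow_le_pow_left₀ hY ?_ L
      nlinarith
    nlinarith
  have hsum : (2 * (L : ℝ) ^ 2 + 2 * L ^ 2 + 2 * L + 2) * ((c / 8 * Y) ^ L * M) ≤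
      (c * Y) ^ L * M := by
    have h0 : 0 ≤ (c / 8 * Y) ^ L * M := by positivity
    calc (2 * (L : ℝ) ^ 2 + 2 * L ^ 2 + 2 * L + 2) * ((c / 8 * Y) ^ L * M)
        ≤ 8 ^ L * ((c / 8 * Y) ^ L * M) := by
          refine mul_le_mul_of_nonneg_right ?_ h0
          linarith
      _ = (c * Y) ^ L * M := by rw [mul_pow (c / 8), ← mul_assoc, ← mul_assoc, e8, mul_pow]
  calc L * X ^ L * (L * P ^ L * (L * Q ^ L * B + 2 * M * (g₁ * ν) ^ L + 2 * M * (g₂ * ν) ^ L)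
        + 2 * M * (g₃ * ν) ^ L) + 2 * M * Y ^ L
      = L * X ^ L * (L * P ^ L * (L * Q ^ L * B)) +
          (L * X ^ L * (L * P ^ L * (2 * M * (g₁ * ν) ^ L)) +
          L * X ^ L * (L * P ^ L * (2 * M * (g₂ * ν) ^ L)) +
          L * X ^ L * (2 * M * (g₃ * ν) ^ L) + 2 * M * Y ^ L) := by ring
    _ ≤ (c * X) ^ L * B + (2 * (L : ℝ) ^ 2 + 2 * L ^ 2 + 2 * L + 2) * ((c / 8 * Y) ^ L * M) := by
        refine add_le_add hT1 ?_
        nlinarith [hT2, hT3, hT4, hT5]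
    _ ≤ (c * X) ^ L * B + (c * Y) ^ L * M := by linarith [hsum]

/-! ### Proof of Theorem 2 -/

/-- **Roy 2001, Theorem 2** (interpolation estimate on `ℂ²`) — discharge of the named fact
`Roy2001_thm2`. The proof follows Roy's architecture (§§2–3: Lemma 1 for the denominators,
interpolation on the bidisc of radius `≍ N` in the coordinates `z u + ω w`, then the Schwarz-type
Lemma 3 along complex lines through the origin to pass from radius `≍ N` to radius `r`), but
every analytic step is carried out on one-variable slices: Taylor expansion in `ω` at the nodes
with `N²` derivatives (the data `D_w^k F(mu + nv)`), Lagrange interpolation in `z` at the `N²`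
nodes `m + na` (well separated by Lemma 1 under condition (2)), Cauchy's estimates, and the
maximum modulus principle on the bidisc. The constant is
`c = max{1, ‖u‖+‖v‖+‖w‖, 8·48(κ+α)(κ+β)·max{1, 2(‖u‖+‖w‖)(κ+α+β)}}` with `α = 1+|a|`,
`β = |b|` (`v = au + bw`), `κ = max{1, 2(‖u‖+‖w‖)/|det(u,w)|}`. [cite: Roy2001, Thm. 2] -/
theorem Roy2001_thm2_holds : Roy2001_thm2 := by
  intro u v w a hli hv
  classical
  obtain ⟨b, hb⟩ := Submodule.mem_span_singleton.1 hv
  have hv' : v = a • u + b • w := by rw [hb]; abel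
  -- constants
  have hdet := det_ne_zero_of_linearIndependent hli
  set dn : ℝ := ‖u.1 * w.2 - u.2 * w.1‖ with hdn
  have hdn0 : 0 < dn := norm_pos_iff.2 hdet
  have hu0 : u ≠ 0 := by
    intro h0; apply hdet; simp [h0]
  have hupos : 0 < ‖u‖ := norm_pos_iff.2 hu0
  set c₄ : ℝ := ‖u‖ + ‖w‖ with hc₄
  have hc₄0 : 0 < c₄ := by positivity
  set K : ℝ := 2 * c₄ / dn with hK
  have hK0 : 0 ≤ K := by positivity
  set κ : ℝ := max 1 K with hκ
  have hκ1 : 1 ≤ κ := le_max_left _ _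
  have hKκ : K ≤ κ := le_max_right _ _
  have hκ0 : 0 ≤ κ := zero_le_one.trans hκ1
  set α : ℝ := 1 + ‖a‖ with hα
  have hα1 : 1 ≤ α := by rw [hα]; linarith [norm_nonneg a]
  set β : ℝ := ‖b‖ with hβ
  have hβ0 : 0 ≤ β := norm_nonneg _
  set P : ℝ := 48 * (κ + α) with hP
  have hP1 : 1 ≤ P := by rw [hP]; linarith
  set Q : ℝ := κ + β with hQ
  have hQ1 : 1 ≤ Q := by rw [hQ]; linarith
  set G : ℝ := 2 * c₄ * (κ + α + β) with hG
  have hG0 : 0 ≤ G := by positivity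
  set c : ℝ := max (max 1 (‖u‖ + ‖v‖ + ‖w‖)) (8 * (P * Q) * max 1 G) with hc
  have hc1 : 1 ≤ c := (le_max_left _ _).trans (le_max_left _ _)
  have hcuvw : ‖u‖ + ‖v‖ + ‖w‖ ≤ c := (le_max_right _ _).trans (le_max_left _ _)
  have hPQ1 : 1 ≤ P * Q := one_le_mul_of_one_le_of_one_le hP1 hQ1
  have hcPQ : 8 * (P * Q) ≤ c :=
    (le_mul_of_one_le_right (by positivity) (le_max_left 1 G)).trans (le_max_right _ _)
  have hcPQG : 8 * (P * Q * G) ≤ c := by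
    calc 8 * (P * Q * G) = 8 * (P * Q) * G := by ring
      _ ≤ 8 * (P * Q) * max 1 G := by gcongr; exact le_max_right _ _
      _ ≤ c := le_max_right _ _
  have hcG : G ≤ c := (le_max_right 1 G).trans
    ((le_mul_of_one_le_left (by positivity) (by linarith)).trans (le_max_right _ _))
  refine ⟨c, hc1, by linarith [norm_nonneg v, norm_nonneg w],
    by linarith [norm_nonneg u, norm_nonneg w], ?_⟩
  intro N hN h2 r R hrR hcr F hF B hB
  -- basic inequalities between the radii
  have hNpos : (0 : ℝ) < N := by exact_mod_cast hN
  have hN1 : (1 : ℝ) ≤ N := by exact_mod_cast hN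
  have hcN : (N : ℝ) ≤ c * N := le_mul_of_one_le_left hNpos.le hc1
  have hr1 : (N : ℝ) ≤ r := hcN.trans hcr
  have hr0 : 0 < r := by linarith
  have hR0 : 0 < R := by linarith
  have hrR2 : r ≤ R / 2 := by linarith
  have hGN : 2 * (2 * c₄ * (κ + α + β)) * N ≤ R := by
    have : G * N ≤ c * N := by gcongr
    rw [hG] at this; linarith
  have huvN : (N : ℝ) * (‖u‖ + ‖v‖) ≤ R / 2 := by
    have : (‖u‖ + ‖v‖) * N ≤ c * N := by gcongr; linarith [norm_nonneg w]
    linarith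
  set L : ℕ := N ^ 2 with hL
  have hL1 : 1 ≤ L := Nat.one_le_pow _ _ hN
  set M : ℝ := torusSup F R with hMdef
  have hM : ∀ q : ℂ × ℂ, ‖q‖ ≤ R → ‖F q‖ ≤ M := fun q hq => norm_le_torusSup hR0 hF hq
  have hM0 : 0 ≤ M := (norm_nonneg _).trans (hM 0 (by simp [hR0.le]))
  have hB0 : 0 ≤ B := by
    have := hB 0 0 0 (by positivity) hN hN
    simp only [pow_zero, mul_one, Nat.factorial_zero, Nat.cast_one, div_one] at this
    exact (norm_nonneg _).trans this
  -- the nodes `x_{(m,n)} = m + n a` and the points `mu + nv = x_{(m,n)} u + n b w`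
  set x : Fin N × Fin N → ℂ := fun j => ((j.1 : ℕ) : ℂ) + ((j.2 : ℕ) : ℂ) * a with hxdef
  have hx : ∀ j, x j = ((j.1 : ℕ) : ℂ) + ((j.2 : ℕ) : ℂ) * a := fun j => rfl
  have hxinj := roy_node_injective h2 hx
  set pt : Fin N × Fin N → ℂ × ℂ := fun j => ((j.1 : ℕ) : ℂ) • u + ((j.2 : ℕ) : ℂ) • v
    with hptdef
  have hpt : ∀ j, pt j = x j • u + (((j.2 : ℕ) : ℂ) * b) • w := by
    intro j
    simp only [hptdef, hxdef, hv', smul_add, add_smul, smul_smul]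
    abel
  have hpt_norm : ∀ j, ‖pt j‖ ≤ N * (‖u‖ + ‖v‖) := by
    intro j
    have h1 : ((j.1 : ℕ) : ℝ) ≤ N := by exact_mod_cast j.1.is_lt.le
    have h2' : ((j.2 : ℕ) : ℝ) ≤ N := by exact_mod_cast j.2.is_lt.le
    calc ‖pt j‖ ≤ ‖((j.1 : ℕ) : ℂ) • u‖ + ‖((j.2 : ℕ) : ℂ) • v‖ := norm_add_le _ _
      _ = (j.1 : ℕ) * ‖u‖ + (j.2 : ℕ) * ‖v‖ := by
          rw [norm_smul, norm_smul, Complex.norm_natCast, Complex.norm_natCast]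
      _ ≤ N * ‖u‖ + N * ‖v‖ := by gcongr
      _ = N * (‖u‖ + ‖v‖) := by ring
  -- the auxiliary radius `Θ` in the coordinates and the ratio `ν = N / R`
  set Θ : ℝ := R / (2 * c₄) with hΘ
  have hΘ0 : 0 < Θ := by positivity
  set ν : ℝ := N / R with hν
  have hν0 : 0 ≤ ν := by positivity
  have hΘw : Θ * ‖w‖ ≤ R / 2 := by
    rw [hΘ]
    calc R / (2 * c₄) * ‖w‖ ≤ R / (2 * c₄) * c₄ := by gcongr; rw [hc₄]; linarith [norm_nonneg u]
      _ = R / 2 := by field_simp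
  have hΘu : Θ * ‖u‖ ≤ R / 2 := by
    rw [hΘ]
    calc R / (2 * c₄) * ‖u‖ ≤ R / (2 * c₄) * c₄ := by gcongr; rw [hc₄]; linarith [norm_nonneg w]
      _ = R / 2 := by field_simp
  have hkey : ∀ t : ℝ, 0 ≤ t → t ≤ κ + α + β → t * N ≤ Θ / 2 := by
    intro t ht0 ht
    rw [hΘ, div_div, le_div_iff₀ (by positivity)]
    calc t * N * (2 * c₄ * 2) = 2 * (2 * c₄ * t) * N := by ring
      _ ≤ 2 * (2 * c₄ * (κ + α + β)) * N := by gcongr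
      _ ≤ R := hGN
  set τ₁ : ℝ := (κ + β) * N with hτ₁
  have hNτ₁ : (N : ℝ) ≤ τ₁ := le_mul_of_one_le_left hNpos.le (by linarith)
  have hτ₁Θ : τ₁ ≤ Θ / 2 := hkey (κ + β) (by positivity) (by linarith)
  have hVΘ : α * N ≤ Θ / 2 := hkey α (by linarith) (by linarith)
  have hρΘ : κ * N ≤ Θ / 2 := hkey κ hκ0 (by linarith)
  -- Step 1: Taylor expansion in the direction `w` at the nodes
  have step1 : ∀ j (t : ℂ), ‖t‖ ≤ τ₁ →
      ‖F (pt j + t • w)‖ ≤ L * (τ₁ / N) ^ L * B + 2 * M * (τ₁ / Θ) ^ L := by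
    intro j t ht
    have hcond : ‖pt j‖ + Θ * ‖w‖ ≤ R := by linarith [hpt_norm j]
    have hsl := diffContOnCl_slice hF (pt j) w hcond
    have hMs : ∀ s ∈ sphere (0 : ℂ) Θ, ‖F (pt j + s • w)‖ ≤ M := fun s hs =>
      hM _ (norm_add_smul_le_of_slice (pt j) w hcond (mem_sphere_zero_iff_norm.1 hs).le)
    have hhead : ∀ k < L, ‖iteratedDeriv k (fun t : ℂ => F (pt j + t • w)) 0‖ / k.factorial ≤
        B / (N : ℝ) ^ k := by
      intro k hk
      have h := hB k j.1 j.2 hk j.1.is_lt j.2.is_lt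
      have e : dirIteratedDeriv w k F (((j.1 : ℕ) : ℂ) • u + ((j.2 : ℕ) : ℂ) • v) =
          iteratedDeriv k (fun t : ℂ => F (pt j + t • w)) 0 := rfl
      rw [e, div_le_iff₀ (by positivity)] at h
      rw [div_le_div_iff₀ (by positivity) (by positivity)]
      linarith
    exact norm_le_of_taylor_coeff_le hΘ0 hsl hMs hB0 hNpos hhead hNτ₁ hτ₁Θ ht
  -- Step 2: interpolation in the direction `u` (fixed `ω`) at the `N²` nodes
  set A₁ : ℝ := L * (τ₁ / N) ^ L * B + 2 * M * (τ₁ / Θ) ^ L with hA₁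
  set Λ : ℝ := (48 * (κ * N + (1 + ‖a‖) * N) / N) ^ (N ^ 2) with hΛ
  have hcard : Fintype.card (Fin N × Fin N) = L := by
    rw [Fintype.card_prod, Fintype.card_fin, hL, sq]
  set M₀ : ℝ := L * Λ * (A₁ + 2 * M * (α * N / Θ) ^ L) + 2 * M * (κ * N / Θ) ^ L with hM₀
  have step2 : ∀ z ω : ℂ, ‖z‖ ≤ κ * N → ‖ω‖ ≤ κ * N → ‖F (z • u + ω • w)‖ ≤ M₀ := by
    intro z ω hz hω
    have hcond : ‖ω • w‖ + Θ * ‖u‖ ≤ R := by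
      have h1 : ‖ω • w‖ ≤ κ * N * c₄ := by
        rw [norm_smul]
        exact mul_le_mul hω (by rw [hc₄]; linarith [norm_nonneg u]) (norm_nonneg _) (by positivity)
      have h2' : κ * N * c₄ ≤ R / 2 := by
        have : 2 * (2 * c₄ * κ) * N ≤ R := le_trans (by gcongr; linarith) hGN
        linarith
      linarith
    have hsl := diffContOnCl_slice hF (ω • w) u hcond
    have hMs : ∀ s ∈ sphere (0 : ℂ) Θ, ‖F (ω • w + s • u)‖ ≤ M := fun s hs =>
      hM _ (norm_add_smul_le_of_slice (ω • w) u hcond (mem_sphere_zero_iff_norm.1 hs).le)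
    have hnodes : ∀ j, ‖F (ω • w + x j • u)‖ ≤ A₁ := by
      intro j
      have e : ω • w + x j • u = pt j + (ω - ((j.2 : ℕ) : ℂ) * b) • w := by
        rw [hpt, sub_smul]; abel
      rw [e]
      refine step1 j _ ?_
      have hj2 : ((j.2 : ℕ) : ℝ) ≤ N := by exact_mod_cast j.2.is_lt.le
      calc ‖ω - ((j.2 : ℕ) : ℂ) * b‖ ≤ ‖ω‖ + ‖((j.2 : ℕ) : ℂ) * b‖ := norm_sub_le _ _
        _ ≤ κ * N + N * β := by
            refine add_le_add hω ?_
            rw [norm_mul, Complex.norm_natCast]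
            exact mul_le_mul_of_nonneg_right hj2 hβ0
        _ = τ₁ := by rw [hτ₁]; ring
    have hΛi : ∀ i, ‖(Lagrange.basis Finset.univ x i).eval z‖ ≤ Λ :=
      fun i => roy_lagrange_basis_le hN h2 hx (by positivity : 0 ≤ κ * N) hz i
    have hVj : ∀ j, ‖x j‖ ≤ α * N := fun j => roy_node_norm_le hx j
    have key := norm_le_of_interpolation hΘ0 hsl hMs hxinj hVj hVΘ hnodes hz hρΘ hΛi
    rw [hcard] at key
    simpa only [add_comm (ω • w) (z • u)] using key
  -- Step 2': the closed bidisc of radius `N` is covered by the coordinate box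
  have step2' : ∀ p : ℂ × ℂ, ‖p‖ ≤ N → ‖F p‖ ≤ M₀ := by
    intro p hp
    obtain ⟨z, ω, hpz, hzb, hωb⟩ := exists_coords hdet p
    have hKN : K * ‖p‖ ≤ κ * N := mul_le_mul hKκ hp (norm_nonneg _) hκ0
    have hzb' : ‖z‖ ≤ K * ‖p‖ := by simpa only [hK, hc₄, hdn] using hzb
    have hωb' : ‖ω‖ ≤ K * ‖p‖ := by simpa only [hK, hc₄, hdn] using hωb
    rw [hpz]
    exact step2 z ω (hzb'.trans hKN) (hωb'.trans hKN)
  have hM₀0 : 0 ≤ M₀ := (norm_nonneg _).trans (step2' 0 (by simp))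
  -- Step 3: Schwarz-type lemma along complex lines through the origin (Roy's Lemma 3)
  have step3 : ∀ p : ℂ × ℂ, ‖p‖ ≤ r → ‖F p‖ ≤ L * (r / N) ^ L * M₀ + 2 * M * (r / R) ^ L := by
    intro p hp
    set q : ℂ × ℂ := ((r : ℂ))⁻¹ • p with hq
    have hq1 : ‖q‖ ≤ 1 := by
      rw [hq, norm_smul, norm_inv, Complex.norm_real, Real.norm_eq_abs, abs_of_pos hr0,
        inv_mul_le_iff₀ hr0, mul_one]
      exact hp
    have hcond : ‖(0 : ℂ × ℂ)‖ + R * ‖q‖ ≤ R := by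
      rw [norm_zero, zero_add]; exact mul_le_of_le_one_right hR0.le hq1
    have hsl := diffContOnCl_slice hF 0 q hcond
    have hMs : ∀ s ∈ sphere (0 : ℂ) R, ‖F (0 + s • q)‖ ≤ M := fun s hs =>
      hM _ (norm_add_smul_le_of_slice 0 q hcond (mem_sphere_zero_iff_norm.1 hs).le)
    have hhead : ∀ k < L, ‖iteratedDeriv k (fun t : ℂ => F (0 + t • q)) 0‖ / k.factorial ≤
        M₀ / (N : ℝ) ^ k := by
      intro k _
      have hsl' : DiffContOnCl ℂ (fun t : ℂ => F (0 + t • q)) (ball 0 N) :=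
        hsl.mono (Metric.ball_subset_ball (by linarith))
      have hsph : ∀ s ∈ sphere (0 : ℂ) (N : ℝ), ‖F (0 + s • q)‖ ≤ M₀ := by
        intro s hs
        refine step2' _ ?_
        rw [zero_add, norm_smul]
        calc ‖s‖ * ‖q‖ ≤ N * 1 :=
            mul_le_mul (mem_sphere_zero_iff_norm.1 hs).le hq1 (norm_nonneg _) hNpos.le
          _ = N := mul_one _
      have hc' := Complex.norm_iteratedDeriv_le_of_forall_mem_sphere_norm_le k hNpos hsl' hsph
      rw [le_div_iff₀ (by positivity)] at hc'
      rw [div_le_div_iff₀ (by positivity) (by positivity)]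
      linarith
    have key := norm_le_of_taylor_coeff_le hR0 hsl hMs hM₀0 hNpos hhead hr1 hrR2
      (y := (r : ℂ)) (by rw [Complex.norm_real, Real.norm_eq_abs, abs_of_pos hr0])
    have e : (0 : ℂ × ℂ) + (r : ℂ) • q = p := by
      rw [hq, zero_add, smul_smul, mul_inv_cancel₀ (by exact_mod_cast hr0.ne'), one_smul]
    simpa only [e] using key
  -- bookkeeping of the constants
  have hfinal : ∀ p : ℂ × ℂ, ‖p‖ ≤ r →
      ‖F p‖ ≤ (c * r / N) ^ L * B + (c * r / R) ^ L * M := by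
    intro p hp
    refine (step3 p hp).trans ?_
    have eΛ : Λ = P ^ L := by
      rw [hΛ, hP, hL]
      congr 1
      rw [hα]
      field_simp
    have eτN : τ₁ / N = Q := by rw [hτ₁, hQ]; field_simp
    have eτΘ : τ₁ / Θ = (2 * c₄ * (κ + β)) * ν := by rw [hτ₁, hΘ, hν]; field_simp
    have eVΘ : α * N / Θ = (2 * c₄ * α) * ν := by rw [hΘ, hν]; field_simp
    have eρΘ : κ * N / Θ = (2 * c₄ * κ) * ν := by rw [hΘ, hν]; field_simp
    have hXν : r / N * ν = r / R := by rw [hν]; field_simp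
    have hbk := thm2_bookkeeping hL1 hB0 hM0 (X := r / N) (Y := r / R) (by positivity)
      (by positivity) hν0 hXν hP1 hQ1 (g₁ := 2 * c₄ * (κ + β)) (g₂ := 2 * c₄ * α)
      (g₃ := 2 * c₄ * κ) (G := G) (by positivity) (by positivity) (by positivity)
      (by rw [hG]; gcongr; linarith) (by rw [hG]; gcongr; linarith) (by rw [hG]; gcongr; linarith)
      hcPQ hcPQG
    calc L * (r / N) ^ L * M₀ + 2 * M * (r / R) ^ L
        = L * (r / N) ^ L * (L * P ^ L * (L * Q ^ L * B + 2 * M * (2 * c₄ * (κ + β) * ν) ^ L +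
            2 * M * (2 * c₄ * α * ν) ^ L) + 2 * M * (2 * c₄ * κ * ν) ^ L) +
            2 * M * (r / R) ^ L := by
          rw [hM₀, hA₁, eΛ, eτN, eτΘ, eVΘ, eρΘ]
      _ ≤ (c * (r / N)) ^ L * B + (c * (r / R)) ^ L * M := hbk
      _ = (c * r / N) ^ L * B + (c * r / R) ^ L * M := by rw [mul_div_assoc, mul_div_assoc]
  exact torusSup_le hr0.le fun z hz1 hz2 => hfinal z (by rw [Prod.norm_def, hz1, hz2, max_self])

end Literature.NumberTheory.Transcendental
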